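import Literature.NumberTheory.Sieve.BombieriFriedlanderIwaniecLemma1HalfFromOffdiag
import HarnessLib

/-!
# BFI 1986/2019, Lemma 1 at `s = 1`: the off-diagonal Kloosterman sums from Deshouillers–Iwaniec's Theorem 11

Topic `Literature/NumberTheory/Sieve`.  Everything here is PROVED (theorems, plus data definitions with
bodies); no named fact is introduced.  One hypothesis predicate parametrised by a weight,
`BFI.L1.DI11For g₀` (Deshouillers–Iwaniec's Theorem 11 at `s = 1` for the dilations of `g₀`), is
defined in the manner of `BFI.Lemma1BoundFor` / `BFI.Lemma1BoundCorrected` and used as the hypothesis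
of the main theorem.

## The point of this file

The tree reduces Theorems 1, 5, 5*, 10 of E. Bombieri, J. B. Friedlander, H. Iwaniec, *Primes in
arithmetic progressions to large moduli*, Acta Math. 156 (1986), the fact `bfi_wellFactorable_level`
and the twin-prime sieve bound `twinSieve_bfi` to ONE estimate (`…Lemma1HalfFromOffdiag`,
`BFI.k1HalfFor_of_offdiag_half`): the bound for the off-diagonal part
`𝓚♯(H₀) = BFI.L1.Koff C D N R (1/2) H₀ B` of the sum `𝓚(C, D, N, R, 1/2)` of BFI's Lemma 1
(= J.-M. Deshouillers, H. Iwaniec, *Kloosterman sums and Fourier coefficients of cusp forms*, Invent.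
Math. 70 (1982), Theorem 12, as corrected in BFI, arXiv:1903.01371 (2019), Lemma 2.1), i.e. for the
frequencies `1 ≤ |h| ≤ H₀` produced by Poisson summation in `d` (`…Lemma1Completion`):
`𝓚♯ = ∑_{r∼R} ∑_{n≤N} B_{nr1} ∑_{c≤5C/4,(c,r)=1} w(c/C) c⁻¹ ∑_{1≤h≤H₀} (Φ_c(h) S(h, n r̄; c) + Φ_c(−h) S(−h, n r̄; c))`.

In the source this is the SECOND half of §9.2 ("Incomplete Kloosterman sums", pp. 280–282), the proof
of Theorem 12 from **Theorem 11** (p. 236: the bound (1.55)–(1.56) for the sums (1.54)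
`𝒯^±(C, M, N, R, S) = ∑_{r∼R} ∑_{0<n≤N} ∑_{s∼S,(r,s)=1} ∑_{0<m≤M} a_m b_{nrs} ∑_{(c,r)=1} g(c,m,n,r,s) S(m r̄, ±n; sc)`
of complete Kloosterman sums with a smooth weight, when `a_m` is the characteristic sequence of an
interval; p. 237: "By standard device from the Fourier series technique, Theorem 11 readily leads to
the following estimate for sums of incomplete Kloosterman sums. Theorem 12").  This file carries out
that half at `s = 1` (the only case the BFI cone uses), so that after it the BFI cone rests on
Theorem 11 of Deshouillers–Iwaniec at `s = 1` — a statement about sums over the modulus `c`,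
`(c, r) = 1`, of complete Kloosterman sums `S(m r̄, ±n; c)` (the Kloosterman sums of the cusp pair
`∞, 0` of `Γ₀(r)`, cf. `…Lemma1KloostermanCusp`) against smooth compactly supported weights,
bilinear in `m` (an interval) and `(n, r)`: exactly what Kuznetsov's formula for `Γ₀(r)` and the
large sieve inequalities for Fourier coefficients of cusp forms (Theorems 1, 2, 5–9 of the source,
§9.1) deliver, and nothing of BFI's or of §9.2 any more.

## Contents (namespace `Literature.NumberTheory.Sieve.BFI.L1`)

1. A three-piece smooth dyadic partition `w = π₀ + π₁ + π₂` of the plateau `w = BFI.plateau1`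
   (`piece`, `sum_piece`; `supp π_i ⊆ [a_i, 2a_i]`, `pa = (1/4, 9/20, 17/20)`), and the three fixed
   **master weights** `G_i(x, y) = π_i(a_i x) y⁻¹ w(x/y)` (`Gw`): smooth on `ℝ²` (`contDiff_Gw`),
   compactly supported in `[1, 2] × [4/5, 8] ⊂ [1, 2] × (0, ∞)` (`hasCompactSupport_Gw`,
   `tsupport_Gw_subset`), with `(M')⁻¹ G_i(c/(a_iC), h/M') = h⁻¹ π_i(c/C) w(ξc/(hD))`,
   `M' = ξ a_i C/D` (`Gw_dilate`) — Deshouillers–Iwaniec's weights `m⁻¹M₁ g(c, ξsc/m, …)` of p. 281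
   are dilations of these three fixed functions, which is what makes Theorem 11 (whose constant
   depends on the weight through (1.53)) applicable uniformly.
2. `c⁻¹ Φ_c(±h) = h⁻¹ ∫ e(∓ξ) w(ξ c/(hD)) dξ` (`inv_mul_fcoef_pos`, `inv_mul_fcoef_neg`: the
   substitution `t = ξc/h` in `Φ_c(h) = 𝓕(w(·/D))(h/c)`), Lemma 9.1 / (9.10) of the source.
3. `diSum g₀ C M N R m₁ m₂ (±1) b` — the sum `𝒯^±` of (1.54) at `s = 1` for the weight
   `g(c, m) = g₀(c/C, m/M)` and `a = 1_{[m₁,m₂]}`, with `𝓢_c(±m; n, r)` (`BFI.L1.kl`) `= S(±m, n r̄; c)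
   = S(±m r̄, n; c)` (`= S(m r̄, ±n; c)` after `x ↦ −x`); `diL C M N R` — the quantity `L` of (1.56)
   at `S = 1/2` in its Theorem-11 form; the hypothesis predicate `DI11For g₀`.
4. `blockSum`, `Koff_half_eq_sum_blockSum` — `𝓚♯ = ∑_j (block_j⁺ + block_j⁻)` over the dyadic blocks
   `[2^j, 2^{j+1})` of `[1, H₀]` (the "`≪ log(M+2)` subintervals `(M₁, 2M₁]`" of p. 281);
   `blockSum_eq_integral` — `block_j^± = ∫ e(∓ξ) W_j(ξ) dξ`; `Wfun_eq_zero` — `W_j` vanishes off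
   `Ξ_j = [2^jD/(5C), 10·2^jD/C]` ((9.13)); `Wfun_eq_sum_diSum` — on `Ξ_j`,
   `W_j(ξ) = ∑_i (M'_i)⁻¹ 𝒯[G_i; a_iC, M'_i]`.
5. `Lam`, `diL_sq_le_Lam`, `range_bound` — the range computation (9.14):
   `(D/C)² M₁ Λ(C, 10M₁, N, R) ≤ 11 max(1,λ)² 𝓚²` for `M₁ ≤ λC/D`,
   `𝓚² = C·½·(R/2+N)(C+DR) + C²D·½·√((R/2+N)R)` (the first two terms of the corrected `𝓘²` at
   `S = 1/2`); `norm_blockSum_le_bulk` — Theorem 11 on `Ξ_j`; `norm_blockSum_le_tail` — the blocks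
   beyond `λC/D`, `λ = (CDNR/2)^{ε/2}`, by the Fourier decay `|Φ_c(±h)| ≤ K_n D λ^{−n}`
   (`norm_fcoef_tail`).
6. **`offdiag_half_of_di11`** — the hypothesis of `BFI.k1HalfFor_of_offdiag_half` from
   `∀ g₀ (smooth, compact support in [1,2] × (0,∞)), DI11For g₀`; whence
   **`k1HalfFor_of_di11`, `BombieriFriedlanderIwaniecTheorem5_of_di11`,
   `BombieriFriedlanderIwaniecTheorem1_of_di11`, `BombieriFriedlanderIwaniecTheorem10_of_di11`,
   `bfi_wellFactorable_level_of_di11`, `twinSieve_bfi_of_di11`.**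

## Faithfulness of the hypothesis `DI11For`

Source read: Deshouillers–Iwaniec 1982 (the free GDZ digitisation of Invent. Math. 70), §1.4
pp. 234–237 (Theorems 8–12, (1.42)–(1.57)) and §9.2 pp. 280–282; the clean modern printing of the
same statements for `q = 1` is S. Drappeau, Proc. LMS 114 (2017) 684–732 (arXiv:1504.05549), §4.3,
Propositions 4.12–4.13 and §4.3.3.  Theorem 10 (p. 236): for `C, M, N, R, S > 0`, `g(c,m,n,r,s)` of
`C^∞` class with compact support in `[C, 2C] × (0, ∞)⁴` such that
`∂^{ν₁+…+ν₅} g ≪ c^{−ν₁} m^{−ν₂} n^{−ν₃} r^{−ν₄} s^{−ν₅}` (1.53), and complex `a_m`, `b_{nrs}`,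
`𝒯^±(C,M,N,R,S) ≪ (CMNRS)^ε L(C,M,N,R,S) ‖a‖ ‖b‖` with
`L² = RS(C²S²R + MN + C²SN)(C²S²R + MN + C²SM)/(C²S²R + MN) + C³S²√(R(N+RS)) M^{1/2}`;
Theorem 11: "If `a_m` is the characteristic sequence of an interval then (1.55) holds with `L`
reduced by the factor `M^{1/4}` in the second term."  `DI11For g₀` is that statement with:
`S = 1/2` (so `s ∼ S` means `s = 1`, and `(CMNRS)^ε ≤ (CMNR)^ε`); `g(c, m, n, r, s) = g₀(c/C, m/M)`
for a FIXED `g₀` with compact support in `[1, 2] × (0, ∞)` — such `g` has compact support in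
`[C, 2C] × (0, ∞)⁴` and satisfies (1.53) with constants depending on `g₀` alone (`c ≍ C`, `m ≍ M` on
the support), so the constant may depend on `g₀` and `ε` (it is quantified after `g₀`, `ε`);
`a = 1_{[m₁, m₂]}`, `m₁ ≥ 1` (terms with `m/M` outside the support of `g₀` vanish, so no upper
constraint on `m₂` is needed, and `‖a‖ ≤ (μM)^{1/2}`, `μ = μ(g₀)`, is absorbed as `M^{1/2}`); the two
signs are `S(m, n r̄; c) = S(m r̄, n; c)` and `S(−m, n r̄; c) = S(m r̄, −n; c)`; the ranges
`C, M > 0`, `N ≥ 1`, `R ≥ 1/2` are a sub-range of the printed positive reals; the `c`-sum is cut at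
`2C` (beyond the support).  Each of these makes `DI11For g₀` a consequence of the printed theorem.

## References

* J.-M. Deshouillers, H. Iwaniec, *Kloosterman sums and Fourier coefficients of cusp forms*, Invent.
  Math. 70 (1982), 219–288: §1.4 Theorems 10, 11, (1.53)–(1.56) p. 236; Theorem 12, (1.57) p. 237;
  §9.2 Lemma 9.1, (9.9)–(9.14) pp. 280–282. [DeshouillersIwaniec1982]
* S. Drappeau, *Sums of Kloosterman sums in arithmetic progressions, and the error term in the
  dispersion method*, Proc. LMS 114 (2017), arXiv:1504.05549, Prop. 4.13 and §4.3.3.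
* E. Bombieri, J. B. Friedlander, H. Iwaniec, Acta Math. 156 (1986), §2 Lemma 1 p. 210; Theorems 1,
  5, 10. [BombieriFriedlanderIwaniecActa1986]
* E. Bombieri, J. B. Friedlander, H. Iwaniec, *Some corrections to an old paper*, arXiv:1903.01371
  (2019), §2 Lemma 2.1. [BombieriFriedlanderIwaniec2019]
-/

noncomputable section

open Finset Real MeasureTheory
open scoped ArithmeticFunction.sigma ContDiff FourierTransform ComplexConjugate Topology

namespace Literature.NumberTheory.Sieve

namespace BFI

namespace L1

/-! ### A three-piece dyadic partition of the plateau `w` -/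

/-- `σ(u) = ψ(20u − 9)` (`ψ = Real.smoothTransition`): `0` for `u ≤ 9/20`, `1` for `u ≥ 1/2`. [folklore] -/
def sig (u : ℝ) : ℝ := Real.smoothTransition (20 * u - 9)

/-- `τ(u) = ψ(20u − 17)`: `0` for `u ≤ 17/20`, `1` for `u ≥ 9/10`. [folklore] -/
def tau (u : ℝ) : ℝ := Real.smoothTransition (20 * u - 17)

/-- `σ(u) = 0` for `u ≤ 9/20`. [folklore] -/
theorem sig_eq_zero {u : ℝ} (h : u ≤ 9 / 20) : sig u = 0 :=
  Real.smoothTransition.zero_of_nonpos (by linarith)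

/-- `σ(u) = 1` for `u ≥ 1/2`. [folklore] -/
theorem sig_eq_one {u : ℝ} (h : 1 / 2 ≤ u) : sig u = 1 :=
  Real.smoothTransition.one_of_one_le (by linarith)

/-- `τ(u) = 0` for `u ≤ 17/20`. [folklore] -/
theorem tau_eq_zero {u : ℝ} (h : u ≤ 17 / 20) : tau u = 0 :=
  Real.smoothTransition.zero_of_nonpos (by linarith)

/-- `τ(u) = 1` for `u ≥ 9/10`. [folklore] -/
theorem tau_eq_one {u : ℝ} (h : 9 / 10 ≤ u) : tau u = 1 :=
  Real.smoothTransition.one_of_one_le (by linarith)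

/-- `σ` is smooth. [folklore] -/
theorem contDiff_sig : ContDiff ℝ ∞ sig :=
  Real.smoothTransition.contDiff.comp ((contDiff_const.mul contDiff_id).sub contDiff_const)

/-- `τ` is smooth. [folklore] -/
theorem contDiff_tau : ContDiff ℝ ∞ tau :=
  Real.smoothTransition.contDiff.comp ((contDiff_const.mul contDiff_id).sub contDiff_const)

/-- The three pieces `π₀ = w(1 − σ)`, `π₁ = wσ(1 − τ)`, `π₂ = wστ` of the plateau `w`
(indexed by `i = 0, 1` and `i ≥ 2`). [folklore] -/
def piece : ℕ → ℝ → ℝ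
  | 0 => fun u => plateau1 u * (1 - sig u)
  | 1 => fun u => plateau1 u * sig u * (1 - tau u)
  | _ => fun u => plateau1 u * sig u * tau u

/-- The dyadic scales `a₀ = 1/4`, `a₁ = 9/20`, `a₂ = 17/20`: `π_i` is supported in `[a_i, 2a_i]`.
[folklore] -/
def pa : ℕ → ℝ
  | 0 => 1 / 4
  | 1 => 9 / 20
  | _ => 17 / 20

/-- `a_i > 0`. [folklore] -/
theorem pa_pos (i : ℕ) : 0 < pa i := by
  rcases i with _ | _ | _ <;> norm_num [pa]

/-- `a_i ≤ 1`. [folklore] -/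
theorem pa_le_one (i : ℕ) : pa i ≤ 1 := by
  rcases i with _ | _ | _ <;> norm_num [pa]

/-- `a_i ≥ 1/4`. [folklore] -/
theorem quarter_le_pa (i : ℕ) : 1 / 4 ≤ pa i := by
  rcases i with _ | _ | _ <;> norm_num [pa]

/-- `π₀ + π₁ + π₂ = w`. [folklore] -/
theorem sum_piece (u : ℝ) : ∑ i ∈ Finset.range 3, piece i u = plateau1 u := by
  simp only [Finset.sum_range_succ, Finset.sum_range_zero, piece]
  ring

/-- The pieces `π_i` are smooth. [folklore] -/
theorem contDiff_piece (i : ℕ) : ContDiff ℝ ∞ (piece i) := by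
  rcases i with _ | _ | _
  · exact contDiff_plateau.mul (contDiff_const.sub contDiff_sig)
  · exact (contDiff_plateau.mul contDiff_sig).mul (contDiff_const.sub contDiff_tau)
  · exact (contDiff_plateau.mul contDiff_sig).mul contDiff_tau

/-- `π_i(u) = 0` for `u ≤ a_i`. [folklore] -/
theorem piece_eq_zero_of_le (i : ℕ) {u : ℝ} (h : u ≤ pa i) : piece i u = 0 := by
  rcases i with _ | _ | _
  · simp only [piece, pa] at h ⊢
    rw [plateau_eq_zero_of_le h, zero_mul]
  · simp only [piece, pa] at h ⊢
    rw [sig_eq_zero h]; ring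
  · simp only [piece, pa] at h ⊢
    rw [tau_eq_zero h]; ring

/-- `π_i(u) = 0` for `u ≥ 2a_i`. [folklore] -/
theorem piece_eq_zero_of_ge (i : ℕ) {u : ℝ} (h : 2 * pa i ≤ u) : piece i u = 0 := by
  rcases i with _ | _ | _
  · simp only [piece, pa] at h ⊢
    rw [sig_eq_one (by linarith)]; ring
  · simp only [piece, pa] at h ⊢
    rw [tau_eq_one (by linarith)]; ring
  · simp only [piece, pa] at h ⊢
    rw [plateau_eq_zero_of_ge (by linarith)]; ring

/-- `π_i(u) = 0` for `u ≥ 5/4` (all pieces carry the factor `w`). [folklore] -/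
theorem piece_eq_zero_of_ge' (i : ℕ) {u : ℝ} (h : 5 / 4 ≤ u) : piece i u = 0 := by
  rcases i with _ | _ | _ <;> simp only [piece] <;> rw [plateau_eq_zero_of_ge h] <;> ring

/-- `π_i(u) = 0` for `u ≤ 1/4`. [folklore] -/
theorem piece_eq_zero_of_le' (i : ℕ) {u : ℝ} (h : u ≤ 1 / 4) : piece i u = 0 :=
  piece_eq_zero_of_le i (h.trans (quarter_le_pa i))

/-! ### The three master weights `G_i(x, y) = π_i(a_i x) y⁻¹ w(x/y)` -/

/-- **The master weights** `G_i(x, y) = π_i(a_i x) · y⁻¹ · w(x / y)` (`i = 0, 1, 2`): fixed smooth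
functions on `ℝ²`, compactly supported in `[1, 2] × [4/5, 8] ⊂ [1, 2] × (0, ∞)`, in terms of which the
off-diagonal weights `h⁻¹ w(c/C) w(ξ c/(hD))` of Deshouillers–Iwaniec's §9.2 are dilations
`(M')⁻¹ G_i(c/C_i, h/M')`, `C_i = a_i C`, `M' = ξ a_i C/D`. [folklore] -/
def Gw (i : ℕ) (p : ℝ × ℝ) : ℝ :=
  piece i (pa i * p.1) * ((p.2)⁻¹ * plateau1 (p.1 / p.2))

/-- `G_i(x, y) = 0` unless `1 < x < 2`. [folklore] -/
theorem Gw_eq_zero_of_fst (i : ℕ) {p : ℝ × ℝ} (h : p.1 ≤ 1 ∨ 2 ≤ p.1) : Gw i p = 0 := by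
  unfold Gw
  rcases h with h | h
  · rw [piece_eq_zero_of_le i, zero_mul]
    have := pa_pos i
    nlinarith
  · rw [piece_eq_zero_of_ge i, zero_mul]
    have := pa_pos i
    nlinarith

/-- `G_i(x, y) = 0` unless `4/5 < y < 8` (given the `x`-support `1 < x < 2`). [folklore] -/
theorem Gw_eq_zero_of_snd (i : ℕ) {p : ℝ × ℝ} (h : p.2 ≤ 4 / 5 ∨ 8 ≤ p.2) : Gw i p = 0 := by
  by_cases hx : p.1 ≤ 1 ∨ 2 ≤ p.1
  · exact Gw_eq_zero_of_fst i hx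
  rw [not_or, not_le, not_le] at hx
  obtain ⟨hx1, hx2⟩ := hx
  unfold Gw
  suffices hw : plateau1 (p.1 / p.2) = 0 by rw [hw, mul_zero, mul_zero]
  rcases h with h | h
  · rcases le_or_gt p.2 0 with hy | hy
    · exact plateau_eq_zero_of_le ((div_nonpos_of_nonneg_of_nonpos (by linarith) hy).trans (by norm_num))
    · refine plateau_eq_zero_of_ge ?_
      rw [le_div_iff₀ hy]; linarith
  · have hy : 0 < p.2 := by linarith
    refine plateau_eq_zero_of_le ?_
    rw [div_le_iff₀ hy]; linarith

/-- The support of `G_i` lies in the box `[1, 2] × [4/5, 8]`. [folklore] -/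
theorem Gw_eq_zero_of_not_mem (i : ℕ) {p : ℝ × ℝ}
    (h : p ∉ Set.Icc (1 : ℝ) 2 ×ˢ Set.Icc (4 / 5 : ℝ) 8) : Gw i p = 0 := by
  rw [Set.mem_prod, Set.mem_Icc, Set.mem_Icc] at h
  by_cases hx : p.1 ≤ 1 ∨ 2 ≤ p.1
  · exact Gw_eq_zero_of_fst i hx
  by_cases hy : p.2 ≤ 4 / 5 ∨ 8 ≤ p.2
  · exact Gw_eq_zero_of_snd i hy
  exfalso
  rw [not_or, not_le, not_le] at hx hy
  exact h ⟨⟨hx.1.le, hx.2.le⟩, ⟨hy.1.le, hy.2.le⟩⟩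

/-- `G_i` has compact support. [folklore] -/
theorem hasCompactSupport_Gw (i : ℕ) : HasCompactSupport (Gw i) :=
  HasCompactSupport.intro ((isCompact_Icc).prod isCompact_Icc) fun _ hp => Gw_eq_zero_of_not_mem i hp

/-- `tsupport G_i ⊆ [1, 2] × (0, ∞)`. [folklore] -/
theorem tsupport_Gw_subset (i : ℕ) : tsupport (Gw i) ⊆ Set.Icc (1 : ℝ) 2 ×ˢ Set.Ioi (0 : ℝ) := by
  have h1 : tsupport (Gw i) ⊆ Set.Icc (1 : ℝ) 2 ×ˢ Set.Icc (4 / 5 : ℝ) 8 := by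
    refine closure_minimal (fun p hp => ?_) (isClosed_Icc.prod isClosed_Icc)
    by_contra h
    exact hp (Gw_eq_zero_of_not_mem i h)
  refine h1.trans (Set.prod_mono le_rfl fun y hy => ?_)
  rw [Set.mem_Icc] at hy
  exact lt_of_lt_of_le (by norm_num) hy.1

/-- `G_i` is smooth on `ℝ²`: it is given by the smooth formula where `y > 1/2`, and vanishes
identically near every point with `y ≤ 1/2`. [folklore] -/
theorem contDiff_Gw (i : ℕ) : ContDiff ℝ ∞ (Gw i) := by
  rw [contDiff_iff_contDiffAt]
  intro p
  by_cases hy : 1 / 2 < p.2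
  · have hy0 : p.2 ≠ 0 := by intro h; rw [h] at hy; norm_num at hy
    unfold Gw
    refine ContDiffAt.mul ?_ (ContDiffAt.mul ?_ ?_)
    · exact ((contDiff_piece i).comp (contDiff_const.mul contDiff_fst)).contDiffAt
    · exact contDiffAt_snd.inv hy0
    · exact contDiff_plateau.contDiffAt.comp p (contDiffAt_fst.div contDiffAt_snd hy0)
  · rw [not_lt] at hy
    have hzero : Gw i =ᶠ[𝓝 p] fun _ => (0 : ℝ) := by
      by_cases hx : 19 / 20 < p.1
      · -- near `p` we have `y < 3/4`, `x > 19/20`, hence `x/y ∉ (1/4, 5/4)` and `w(x/y) = 0`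
        have hV : {q : ℝ × ℝ | q.2 < 3 / 4} ∩ {q : ℝ × ℝ | 19 / 20 < q.1} ∈ 𝓝 p := by
          refine IsOpen.mem_nhds ?_ ⟨by show p.2 < 3 / 4; linarith, hx⟩
          exact (isOpen_lt continuous_snd continuous_const).inter
            (isOpen_lt continuous_const continuous_fst)
        refine Filter.eventuallyEq_of_mem hV fun q hq => ?_
        obtain ⟨hq2, hq1⟩ := hq
        simp only [Set.mem_setOf_eq] at hq1 hq2
        unfold Gw
        suffices hw : plateau1 (q.1 / q.2) = 0 by rw [hw, mul_zero, mul_zero]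
        rcases le_or_gt q.2 0 with hq | hq
        · exact plateau_eq_zero_of_le
            ((div_nonpos_of_nonneg_of_nonpos (by linarith) hq).trans (by norm_num))
        · refine plateau_eq_zero_of_ge ?_
          rw [le_div_iff₀ hq]; linarith
      · -- near `p` we have `x < 1`, hence `π_i(a_i x) = 0`
        rw [not_lt] at hx
        have hV : {q : ℝ × ℝ | q.1 < 1} ∈ 𝓝 p :=
          IsOpen.mem_nhds (isOpen_lt continuous_fst continuous_const) (by show p.1 < 1; linarith)
        refine Filter.eventuallyEq_of_mem hV fun q hq => ?_
        simp only [Set.mem_setOf_eq] at hq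
        exact Gw_eq_zero_of_fst i (Or.inl hq.le)
    exact (contDiffAt_const (c := (0 : ℝ))).congr_of_eventuallyEq hzero

/-- **The dilation identity**: for `C, D, ξ > 0`, `h ≠ 0` and `M' = ξ a_i C / D`,
`(M')⁻¹ G_i(c/(a_i C), h/M') = h⁻¹ π_i(c/C) w(ξ c/(h D))`. [folklore] -/
theorem Gw_dilate (i : ℕ) {C D ξ : ℝ} (hC : 0 < C) (hD : 0 < D) (hξ : 0 < ξ) {h : ℝ} (hh : h ≠ 0)
    (c : ℝ) :
    (ξ * (pa i * C) / D)⁻¹ * Gw i (c / (pa i * C), h / (ξ * (pa i * C) / D)) =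
      h⁻¹ * (piece i (c / C) * plateau1 (ξ * c / (h * D))) := by
  have ha : 0 < pa i := pa_pos i
  have hM : 0 < ξ * (pa i * C) / D := by positivity
  unfold Gw
  have e1 : pa i * (c / (pa i * C)) = c / C := by field_simp
  have e2 : c / (pa i * C) / (h / (ξ * (pa i * C) / D)) = ξ * c / (h * D) := by
    field_simp
  rw [e1, e2]
  field_simp

/-- For `ξ ≤ 0` the weight `w(ξ c/(hD))` vanishes (`c ≥ 0`, `h, D > 0`). [folklore] -/
theorem plateau1_arg_nonpos {ξ c h D : ℝ} (hξ : ξ ≤ 0) (hc : 0 ≤ c) (hh : 0 < h) (hD : 0 < D) :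
    plateau1 (ξ * c / (h * D)) = 0 :=
  plateau_eq_zero_of_le ((div_nonpos_of_nonpos_of_nonneg (mul_nonpos_of_nonpos_of_nonneg hξ hc)
    (by positivity)).trans (by norm_num))


/-! ### The Fourier coefficients `Φ_c(±h)` as `ξ`-integrals (the substitution `t = ξ c/h`) -/

/-- `Φ_c(h) = 𝓕(w(·/D))(h/c) = ∫ e(−v h/c) w(v/D) dv` (`D > 0`). [folklore] -/
theorem fcoef_eq_integral {D : ℝ} (hD : 0 < D) (c : ℕ) (h : ℤ) :
    fcoef (D / 2) (D / 4) c h =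
      ∫ v : ℝ, (𝐞 (-(v * ((h : ℝ) / c))) : ℂ) * ((plateau1 (v / D) : ℝ) : ℂ) := by
  rw [fcoef_def, Real.fourier_real_eq]
  refine integral_congr_ae (Filter.Eventually.of_forall fun v => ?_)
  simp only [Circle.smul_def, smul_eq_mul, bumpC_apply, plateau1_div hD]

/-- The substitution `v = (c/h) ξ` in `∫ e(−ϑ v h/c) w(v/D) dv` (`c, h > 0`, `ϑ = ±1`):
`∫ e(−ϑ v h/c) w(v/D) dv = (c/h) ∫ e(−ϑ ξ) w(ξ c/(hD)) dξ`. [folklore] -/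
theorem integral_subst {D : ℝ} {c h : ℕ} (hc : 0 < c) (hh : 0 < h) (ϑ : ℝ) :
    ∫ v : ℝ, (𝐞 (-(v * ((ϑ * h : ℝ) / c))) : ℂ) * ((plateau1 (v / D) : ℝ) : ℂ) =
      (((c : ℝ) / h : ℝ) : ℂ) *
        ∫ ξ : ℝ, (𝐞 (-(ϑ * ξ)) : ℂ) * ((plateau1 (ξ * c / (h * D)) : ℝ) : ℂ) := by
  have hc' : (0 : ℝ) < c := by exact_mod_cast hc
  have hh' : (0 : ℝ) < h := by exact_mod_cast hh
  have hpos : 0 < (c : ℝ) / h := by positivity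
  set g : ℝ → ℂ := fun v => (𝐞 (-(v * ((ϑ * h : ℝ) / c))) : ℂ) * ((plateau1 (v / D) : ℝ) : ℂ)
    with hg
  have hsub := Measure.integral_comp_mul_left g ((c : ℝ) / h)
  rw [abs_of_pos (inv_pos.2 hpos)] at hsub
  have h1 : ∫ v, g v = ((c : ℝ) / h) • ∫ ξ, g ((c : ℝ) / h * ξ) := by
    rw [hsub, smul_smul, mul_inv_cancel₀ hpos.ne', one_smul]
  have h2 : (fun ξ => g ((c : ℝ) / h * ξ)) =
      fun ξ => (𝐞 (-(ϑ * ξ)) : ℂ) * ((plateau1 (ξ * c / (h * D)) : ℝ) : ℂ) := by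
    funext ξ
    simp only [hg]
    have e1 : -((c : ℝ) / h * ξ * ((ϑ * h : ℝ) / c)) = -(ϑ * ξ) := by field_simp
    have e2 : (c : ℝ) / h * ξ / D = ξ * c / (h * D) := by
      rcases eq_or_ne D 0 with hD | hD
      · rw [hD, mul_zero, div_zero, div_zero]
      · field_simp
    rw [e1, e2]
  change ∫ v, g v = _
  rw [h1, h2, Complex.real_smul]

/-- **`c⁻¹ Φ_c(h) = h⁻¹ ∫ e(−ξ) w(ξ c/(hD)) dξ`** for `c, h ≥ 1`, `D > 0`. [folklore] -/
theorem inv_mul_fcoef_pos {D : ℝ} (hD : 0 < D) {c h : ℕ} (hc : 0 < c) (hh : 0 < h) :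
    ((c : ℂ))⁻¹ * fcoef (D / 2) (D / 4) c h =
      ((h : ℂ))⁻¹ * ∫ ξ : ℝ, (𝐞 (-ξ) : ℂ) * ((plateau1 (ξ * c / (h * D)) : ℝ) : ℂ) := by
  have hc' : (c : ℂ) ≠ 0 := by exact_mod_cast hc.ne'
  have hh' : (h : ℂ) ≠ 0 := by exact_mod_cast hh.ne'
  rw [fcoef_eq_integral hD]
  have := integral_subst (D := D) hc hh 1
  simp only [one_mul, Int.cast_natCast] at this ⊢
  rw [this, ← mul_assoc]
  congr 1
  push_cast
  field_simp

/-- **`c⁻¹ Φ_c(−h) = h⁻¹ ∫ e(ξ) w(ξ c/(hD)) dξ`** for `c, h ≥ 1`, `D > 0`. [folklore] -/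
theorem inv_mul_fcoef_neg {D : ℝ} (hD : 0 < D) {c h : ℕ} (hc : 0 < c) (hh : 0 < h) :
    ((c : ℂ))⁻¹ * fcoef (D / 2) (D / 4) c (-(h : ℤ)) =
      ((h : ℂ))⁻¹ * ∫ ξ : ℝ, (𝐞 ξ : ℂ) * ((plateau1 (ξ * c / (h * D)) : ℝ) : ℂ) := by
  have hc' : (c : ℂ) ≠ 0 := by exact_mod_cast hc.ne'
  have hh' : (h : ℂ) ≠ 0 := by exact_mod_cast hh.ne'
  rw [fcoef_eq_integral hD]
  have := integral_subst (D := D) hc hh (-1)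
  simp only [neg_mul, one_mul, neg_neg, Int.cast_neg, Int.cast_natCast] at this ⊢
  rw [this, ← mul_assoc]
  congr 1
  push_cast
  field_simp

/-! ### Deshouillers–Iwaniec's sums `𝒯^±` at `s = 1` for dilation weights, and the quantity `L` -/

/-- **Deshouillers–Iwaniec's sum `𝒯(C, M, N, R)` of Theorem 10/11 at `s = 1`, for a dilation weight
`g(c, m) = g₀(c/C, m/M)` and `a_m` the characteristic sequence of the interval `[m₁, m₂]`**:
`∑_{r∼R} ∑_{0<n≤N} b_{nr} ∑_{m₁≤m≤m₂} ∑_{c ≤ 2C, (c,r)=1} g₀(c/C, m/M) 𝓢_c(±m; n, r)`, where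
`𝓢_c(m; n, r) = S(m, n r̄; c) = S(m r̄, n; c)` and `𝓢_c(−m; n, r) = S(−m r̄, n; c) = S(m r̄, −n; c)`
(substitute `x ↦ −x`) are the Kloosterman sums `S(m r̄, ±n; sc)` of (1.54) of the source at `s = 1`
(`sgn = ±1`). [cite: DeshouillersIwaniec1982, §1.4 (1.54) p. 236] -/
def diSum (g₀ : ℝ × ℝ → ℝ) (C M : ℝ) (N : ℕ) (R : ℝ) (m₁ m₂ : ℕ) (sgn : ℤ) (b : ℕ → ℕ → ℂ) : ℂ :=
  ∑ r ∈ dyadic R, ∑ n ∈ Finset.Icc 1 N, b n r *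
    ∑ m ∈ Finset.Icc m₁ m₂, ∑ c ∈ (Finset.Icc 1 ⌊2 * C⌋₊).filter (fun c => r.Coprime c),
      ((g₀ ((c : ℝ) / C, (m : ℝ) / M) : ℝ) : ℂ) * kl c r n (sgn * m)

/-- **The quantity `L(C, M, N, R, S)` of Deshouillers–Iwaniec's Theorem 11 at `S = 1/2`**
((1.56) with the factor `M^{1/2}` of its second term removed, as Theorem 11 states for `a_m` the
characteristic sequence of an interval; in the clean form printed by Drappeau, Prop. 4.13 with `q = 1`:
`L² = RS (C²S²R + MN + C²SN)(C²S²R + MN + C²SM)/(C²S²R + MN) + C³S²√(R(N + RS))`).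
[cite: DeshouillersIwaniec1982, §1.4 (1.56) p. 236, Theorem 11] -/
def diL (C M N R : ℝ) : ℝ :=
  Real.sqrt (R * (1 / 2) * ((C ^ 2 * (1 / 2) ^ 2 * R + M * N + C ^ 2 * (1 / 2) * N) *
      (C ^ 2 * (1 / 2) ^ 2 * R + M * N + C ^ 2 * (1 / 2) * M) / (C ^ 2 * (1 / 2) ^ 2 * R + M * N)) +
    C ^ 3 * (1 / 2) ^ 2 * Real.sqrt (R * (N + R * (1 / 2))))

/-- `L ≥ 0`. [folklore] -/
theorem diL_nonneg (C M N R : ℝ) : 0 ≤ diL C M N R := Real.sqrt_nonneg _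

/-- **Deshouillers–Iwaniec's Theorem 11 at `s = 1` for the dilations of one weight `g₀`** — the
hypothesis predicate of this file (parametrised by the weight, in the manner of `BFI.Lemma1BoundFor`):
for every `ε > 0` there is `K = K(g₀, ε)` such that for all `C, M > 0`, `N ≥ 1`, `R ≥ 1/2`, all
complex `b_{nr}`, every interval `[m₁, m₂]` with `m₁ ≥ 1` and both signs `sgn = ±1`,
`|𝒯| ≤ K (CMNR)^ε L(C, M, N, R, 1/2) M^{1/2} ‖b‖`.
For `g₀` smooth with compact support in `[1, 2] × (0, ∞)` this is the statement of Theorem 11 of the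
source (with Theorem 10's notation (1.53)–(1.56)) at `S = 1/2` (so that `S < s ≤ 2S` means `s = 1`),
`a_m = 1_{[m₁,m₂]}` (`‖a‖ ≤ M^{1/2}`; terms with `m > μM` vanish, `μ = μ(g₀)`), weight
`g(c, m, n, r, s) = g₀(c/C, m/M)`, which has compact support in `[C, 2C] × (0, ∞)⁴` and satisfies
(1.53) with constants depending on `g₀` alone; the same statement, for `q = 1`, is Drappeau,
Proc. LMS 114 (2017), Prop. 4.13.  It rests on Kuznetsov's formula and the large sieve inequalities
for the Fourier coefficients of cusp forms on `Γ₀(rs)` (Theorems 1, 2, 5–9 of the source), none of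
which is in Mathlib or the tree. [cite: DeshouillersIwaniec1982, §1.4 Theorem 11 p. 236] -/
def DI11For (g₀ : ℝ × ℝ → ℝ) : Prop :=
  ∀ ε : ℝ, 0 < ε → ∃ K : ℝ, ∀ C M N R : ℝ, 0 < C → 0 < M → 1 ≤ N → 1 / 2 ≤ R →
    ∀ b : ℕ → ℕ → ℂ, ∀ m₁ m₂ : ℕ, 1 ≤ m₁ → ∀ sgn : ℤ, (sgn = 1 ∨ sgn = -1) →
      ‖diSum g₀ C M ⌊N⌋₊ R m₁ m₂ sgn b‖ ≤
        K * (C * M * N * R) ^ ε * diL C M N R * Real.sqrt M *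
          Real.sqrt (∑ r ∈ dyadic R, ∑ n ∈ Finset.Icc 1 ⌊N⌋₊, ‖b n r‖ ^ 2)

/-! ### Elementary bounds: `|𝓢| ≤ k`, dyadic blocks -/

/-- The trivial bound `|𝓢_k(h; n, r)| ≤ k`. [folklore] -/
theorem norm_kl_le (k r : ℕ) (n h : ℤ) : ‖kl k r n h‖ ≤ k := by
  unfold kl
  refine (norm_sum_le _ _).trans ?_
  have h1 : ∀ x ∈ (Finset.range k).filter (fun x => x.Coprime k),
      ‖(𝐞 ((n : ℝ) * (((((r * x : ℕ) : ZMod k))⁻¹).val : ℝ) / k) : ℂ) * (𝐞 ((x : ℝ) * h / k) : ℂ)‖ = 1 := by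
    intro x _
    rw [norm_mul, Circle.norm_coe, Circle.norm_coe, mul_one]
  rw [Finset.sum_congr rfl h1, Finset.sum_const, nsmul_eq_mul, mul_one]
  exact_mod_cast (Finset.card_filter_le _ _).trans (Finset.card_range k).le

/-- The `j`-th dyadic block of `[1, H₀]`: `[2^j, min(H₀, 2^{j+1} − 1)]`. [folklore] -/
def block (H₀ j : ℕ) : Finset ℕ := Finset.Icc (2 ^ j) (min H₀ (2 ^ (j + 1) - 1))

/-- Membership in the `j`-th block. [folklore] -/
theorem mem_block {H₀ j h : ℕ} : h ∈ block H₀ j ↔ 2 ^ j ≤ h ∧ h ≤ H₀ ∧ h < 2 ^ (j + 1) := by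
  rw [block, Finset.mem_Icc]
  have : 0 < 2 ^ (j + 1) := Nat.two_pow_pos _
  omega

/-- The `j`-th block is the fibre `{h ∈ [1, H₀] : ⌊log₂ h⌋ = j}`. [folklore] -/
theorem filter_log_eq_block (H₀ j : ℕ) :
    (Finset.Icc 1 H₀).filter (fun h => Nat.log 2 h = j) = block H₀ j := by
  ext h
  rw [Finset.mem_filter, Finset.mem_Icc, mem_block]
  constructor
  · rintro ⟨⟨h1, h2⟩, h3⟩
    have h0 : h ≠ 0 := by omega
    have := (Nat.log_eq_iff (Or.inr ⟨one_lt_two, h0⟩)).1 h3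
    exact ⟨this.1, h2, this.2⟩
  · rintro ⟨h1, h2, h3⟩
    have hpos : 1 ≤ h := le_trans (Nat.one_le_two_pow) h1
    refine ⟨⟨hpos, h2⟩, ?_⟩
    exact (Nat.log_eq_iff (Or.inr ⟨one_lt_two, by omega⟩)).2 ⟨h1, h3⟩

/-- **Dyadic decomposition** `∑_{1≤h≤H₀} f(h) = ∑_{j ≤ log₂ H₀} ∑_{h ∈ block_j} f(h)`. [folklore] -/
theorem sum_Icc_eq_sum_block {A : Type*} [AddCommMonoid A] (H₀ : ℕ) (f : ℕ → A) :
    ∑ h ∈ Finset.Icc 1 H₀, f h =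
      ∑ j ∈ Finset.range (Nat.log 2 H₀ + 1), ∑ h ∈ block H₀ j, f h := by
  rw [← Finset.sum_fiberwise_of_maps_to (g := fun h => Nat.log 2 h)
    (t := Finset.range (Nat.log 2 H₀ + 1))]
  · exact Finset.sum_congr rfl fun j _ => by rw [filter_log_eq_block]
  · intro h hh
    rw [Finset.mem_Icc] at hh
    rw [Finset.mem_range, Nat.lt_add_one_iff]
    exact Nat.log_mono_right hh.2

/-- Elements of the `j`-th block satisfy `2^j ≤ h < 2^{j+1}` and `1 ≤ h ≤ H₀`. [folklore] -/
theorem block_bounds {H₀ j h : ℕ} (hh : h ∈ block H₀ j) :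
    (2 : ℝ) ^ j ≤ h ∧ (h : ℝ) < 2 * 2 ^ j ∧ 1 ≤ h ∧ h ≤ H₀ := by
  rw [mem_block] at hh
  obtain ⟨h1, h2, h3⟩ := hh
  refine ⟨by exact_mod_cast h1, ?_, le_trans Nat.one_le_two_pow h1, h2⟩
  have : (h : ℝ) < (2 : ℝ) ^ (j + 1) := by exact_mod_cast h3
  rw [pow_succ] at this
  linarith

/-- `2^j ≤ H₀` for the non-trivial blocks (`j ≤ log₂ H₀`, `H₀ ≥ 1`). [folklore] -/
theorem two_pow_le_of_mem_range' {H₀ j : ℕ} (hH : 1 ≤ H₀) (hj : j ∈ Finset.range (Nat.log 2 H₀ + 1)) :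
    (2 : ℝ) ^ j ≤ H₀ := by
  have h1 : 2 ^ j ≤ H₀ :=
    (Nat.pow_le_pow_right two_pos (Nat.lt_succ_iff.1 (Finset.mem_range.1 hj))).trans
      (Nat.pow_log_le_self 2 (by omega))
  exact_mod_cast h1



/-! ### The off-diagonal sum at `s = 1` in dyadic blocks -/

/-- The contribution of the `j`-th dyadic block of frequencies, sign `sgn = ±1`, to `𝓚♯` at `s = 1`:
`∑_{r∼R} ∑_{n≤N} B_{nr1} ∑_{c≤5C/4,(c,r)=1} ∑_{h ∈ block_j} w(c/C) c⁻¹ Φ_c(sgn h) 𝓢_c(sgn h; n, r)`. [folklore] -/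
def blockSum (C D : ℝ) (N : ℕ) (R : ℝ) (H₀ : ℕ) (B : ℕ → ℕ → ℕ → ℂ) (j : ℕ) (sgn : ℤ) : ℂ :=
  ∑ r ∈ dyadic R, ∑ n ∈ Finset.Icc 1 N, B n r 1 *
    ∑ c ∈ (Finset.Icc 1 ⌊5 / 4 * C⌋₊).filter (fun c => r.Coprime c),
      ∑ h ∈ block H₀ j, ((plateau1 (c / C) : ℝ) : ℂ) *
        (((c : ℂ))⁻¹ * fcoef (D / 2) (D / 4) c (sgn * h)) * kl c r n (sgn * h)

/-- **`𝓚♯` at `S = 1/2` is the sum of its dyadic blocks** (both signs). [folklore] -/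
theorem Koff_half_eq_sum_blockSum (C D : ℝ) (N : ℕ) (R : ℝ) (H₀ : ℕ) (B : ℕ → ℕ → ℕ → ℂ) :
    Koff C D N R (1 / 2) H₀ B =
      ∑ j ∈ Finset.range (Nat.log 2 H₀ + 1), (blockSum C D N R H₀ B j 1 + blockSum C D N R H₀ B j (-1)) := by
  -- the inner `(c, h)`-sums, block by block
  have inner : ∀ (r n c : ℕ),
      ((plateau1 (c / C) : ℝ) : ℂ) * (((c : ℂ))⁻¹ *
        ∑ h ∈ Finset.Icc 1 H₀, (fcoef (D / 2) (D / 4) c h * kl c r n h +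
          fcoef (D / 2) (D / 4) c (-(h : ℤ)) * kl c r n (-(h : ℤ)))) =
      ∑ j ∈ Finset.range (Nat.log 2 H₀ + 1), ∑ h ∈ block H₀ j,
        (((plateau1 (c / C) : ℝ) : ℂ) * (((c : ℂ))⁻¹ * fcoef (D / 2) (D / 4) c ((1 : ℤ) * h)) *
            kl c r n ((1 : ℤ) * h) +
          ((plateau1 (c / C) : ℝ) : ℂ) * (((c : ℂ))⁻¹ * fcoef (D / 2) (D / 4) c ((-1 : ℤ) * h)) *
            kl c r n ((-1 : ℤ) * h)) := by
    intro r n c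
    rw [← sum_Icc_eq_sum_block, Finset.mul_sum, Finset.mul_sum]
    refine Finset.sum_congr rfl fun h _ => ?_
    simp only [one_mul, neg_one_mul]
    ring
  unfold Koff blockSum
  rw [L6.dyadic_half]
  simp only [Finset.sum_singleton, one_mul]
  simp_rw [inner]
  -- now reorder the finite sums: bring `j` outside
  have step1 : ∀ (g : ℂ) (S : Finset ℕ) (φ : ℕ → ℕ → ℕ → ℂ),
      g * ∑ c ∈ S, ∑ j ∈ Finset.range (Nat.log 2 H₀ + 1), ∑ h ∈ block H₀ j, φ c j h =
        ∑ j ∈ Finset.range (Nat.log 2 H₀ + 1), g * ∑ c ∈ S, ∑ h ∈ block H₀ j, φ c j h := by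
    intro g S φ
    rw [Finset.sum_comm, Finset.mul_sum]
  simp_rw [step1]
  rw [Finset.sum_congr rfl fun r _ => Finset.sum_comm, Finset.sum_comm]
  refine Finset.sum_congr rfl fun j _ => ?_
  simp only [Finset.sum_add_distrib, mul_add, one_mul]

/-- The real weight `h⁻¹ w(c/C) w(ξ c/(hD))` of the block integrand. [folklore] -/
def wt (C D ξ : ℝ) (c h : ℕ) : ℝ := ((h : ℝ))⁻¹ * (plateau1 (c / C) * plateau1 (ξ * c / (h * D)))

/-- **The `ξ`-integrand of a block**:
`W_j(ξ) = ∑_{r∼R} ∑_{n≤N} B_{nr1} ∑_{c,(c,r)=1} ∑_{h∈block_j} h⁻¹ w(c/C) w(ξc/(hD)) 𝓢_c(sgn h; n, r)`. [folklore] -/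
def Wfun (C D : ℝ) (N : ℕ) (R : ℝ) (H₀ : ℕ) (B : ℕ → ℕ → ℕ → ℂ) (j : ℕ) (sgn : ℤ) (ξ : ℝ) : ℂ :=
  ∑ r ∈ dyadic R, ∑ n ∈ Finset.Icc 1 N, B n r 1 *
    ∑ c ∈ (Finset.Icc 1 ⌊5 / 4 * C⌋₊).filter (fun c => r.Coprime c),
      ∑ h ∈ block H₀ j, ((wt C D ξ c h : ℝ) : ℂ) * kl c r n (sgn * h)

/-- `ξ ↦ e(aξ)` is continuous (as a complex-valued function). [folklore] -/
theorem continuous_e_mul (a : ℝ) : Continuous fun ξ : ℝ => ((𝐞 (a * ξ) : Circle) : ℂ) := by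
  have : (fun ξ : ℝ => ((𝐞 (a * ξ) : Circle) : ℂ)) =
      fun ξ => Complex.exp (((2 * π * (a * ξ) : ℝ) : ℂ) * Complex.I) := by
    funext ξ; exact Real.fourierChar_apply _
  rw [this]
  fun_prop

/-- `ξ ↦ w(ξ c/(hD))` is continuous. [folklore] -/
theorem continuous_plateau1_lin (c h D : ℝ) : Continuous fun ξ : ℝ => plateau1 (ξ * c / (h * D)) :=
  contDiff_plateau.continuous.comp ((continuous_id.mul continuous_const).div_const _)

/-- `ξ ↦ w(ξ c/(hD))` has compact support when `c, h, D > 0`. [folklore] -/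
theorem hasCompactSupport_plateau1_lin {c h D : ℝ} (hc : 0 < c) (hh : 0 < h) (hD : 0 < D) :
    HasCompactSupport fun ξ : ℝ => plateau1 (ξ * c / (h * D)) := by
  refine HasCompactSupport.intro (isCompact_Icc (a := 0) (b := 2 * h * D / c)) fun ξ hξ => ?_
  rw [Set.mem_Icc, not_and_or, not_le, not_le] at hξ
  have hhD : 0 < h * D := by positivity
  rcases hξ with hξ | hξ
  · exact plateau_eq_zero_of_le ((div_nonpos_of_nonpos_of_nonneg
      (mul_nonpos_of_nonpos_of_nonneg hξ.le hc.le) hhD.le).trans (by norm_num))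
  · refine plateau_eq_zero_of_ge ?_
    rw [le_div_iff₀ hhD]
    rw [div_lt_iff₀ hc] at hξ
    nlinarith

/-- Each term of the block integrand is integrable in `ξ`. [folklore] -/
theorem integrable_term {C D : ℝ} (hD : 0 < D) {c h : ℕ} (hc : 0 < c) (hh : 0 < h) (a : ℝ) (z : ℂ) :
    Integrable fun ξ : ℝ => ((𝐞 (a * ξ) : Circle) : ℂ) * (((wt C D ξ c h : ℝ) : ℂ) * z) := by
  have hc' : (0 : ℝ) < c := by exact_mod_cast hc
  have hh' : (0 : ℝ) < h := by exact_mod_cast hh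
  unfold wt
  have hcont : Continuous fun ξ : ℝ => ((𝐞 (a * ξ) : Circle) : ℂ) *
      (((((h : ℝ))⁻¹ * (plateau1 (c / C) * plateau1 (ξ * c / (h * D))) : ℝ) : ℂ) * z) := by
    refine (continuous_e_mul a).mul (Continuous.mul ?_ continuous_const)
    exact Complex.continuous_ofReal.comp
      (continuous_const.mul (continuous_const.mul (continuous_plateau1_lin _ _ _)))
  refine hcont.integrable_of_hasCompactSupport ?_
  have h1 : HasCompactSupport fun ξ : ℝ =>
      (((((h : ℝ))⁻¹ * (plateau1 (c / C) * plateau1 (ξ * c / (h * D))) : ℝ) : ℂ) * z) := by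
    refine HasCompactSupport.mul_right ?_
    have h2 : HasCompactSupport fun ξ : ℝ =>
        ((h : ℝ))⁻¹ * (plateau1 (c / C) * plateau1 (ξ * c / (h * D))) :=
      (hasCompactSupport_plateau1_lin hc' hh' hD).mul_left.mul_left
    exact h2.comp_left Complex.ofReal_zero
  exact h1.mul_left

/-- **Each block is a `ξ`-integral** (`sgn = ±1`, `D > 0`):
`blockSum_j^{sgn} = ∫ e(−sgn ξ) W_j^{sgn}(ξ) dξ`. [cite: DeshouillersIwaniec1982, §9.2 (9.10) p. 280] -/
theorem blockSum_eq_integral {C D : ℝ} (hD : 0 < D) (N : ℕ) (R : ℝ) (H₀ : ℕ) (B : ℕ → ℕ → ℕ → ℂ)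
    (j : ℕ) {sgn : ℤ} (hs : sgn = 1 ∨ sgn = -1) :
    blockSum C D N R H₀ B j sgn =
      ∫ ξ : ℝ, ((𝐞 (-(sgn * ξ)) : Circle) : ℂ) * Wfun C D N R H₀ B j sgn ξ := by
  have hR0 : ∀ r ∈ dyadic R, ∀ c ∈ (Finset.Icc 1 ⌊5 / 4 * C⌋₊).filter (fun c => r.Coprime c), 0 < c := by
    intro r _ c hc
    exact (Finset.mem_Icc.1 (Finset.mem_filter.1 hc).1).1
  have hh0 : ∀ h ∈ block H₀ j, 0 < h := fun h hh => (block_bounds hh).2.2.1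
  -- the termwise identity
  have term : ∀ (r n c h : ℕ), 0 < c → 0 < h →
      ((plateau1 (c / C) : ℝ) : ℂ) * (((c : ℂ))⁻¹ * fcoef (D / 2) (D / 4) c (sgn * h)) * kl c r n (sgn * h) =
        ∫ ξ : ℝ, ((𝐞 (-(sgn * ξ)) : Circle) : ℂ) * (((wt C D ξ c h : ℝ) : ℂ) * kl c r n (sgn * h)) := by
    intro r n c h hc hh
    have e1 : (fun ξ : ℝ => ((𝐞 (-(sgn * ξ)) : Circle) : ℂ) * (((wt C D ξ c h : ℝ) : ℂ) * kl c r n (sgn * h))) =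
        fun ξ : ℝ => (((((h : ℝ))⁻¹ * plateau1 (c / C) : ℝ) : ℂ) * kl c r n (sgn * h)) *
          (((𝐞 (-(sgn * ξ)) : Circle) : ℂ) * ((plateau1 (ξ * c / (h * D)) : ℝ) : ℂ)) := by
      funext ξ
      unfold wt
      push_cast
      ring
    rw [e1, integral_const_mul]
    rcases hs with rfl | rfl
    · have h2 := inv_mul_fcoef_pos (D := D) hD hc hh
      simp only [Int.cast_one, one_mul] at h2 ⊢
      rw [h2]
      push_cast
      ring
    · have h2 := inv_mul_fcoef_neg (D := D) hD hc hh
      simp only [Int.cast_neg, Int.cast_one, neg_mul, one_mul, neg_neg] at h2 ⊢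
      rw [h2]
      push_cast
      ring
  -- exchange the finite sums with the integral
  unfold blockSum Wfun
  symm
  rw [show (fun ξ : ℝ => ((𝐞 (-(sgn * ξ)) : Circle) : ℂ) *
      ∑ r ∈ dyadic R, ∑ n ∈ Finset.Icc 1 N, B n r 1 *
        ∑ c ∈ (Finset.Icc 1 ⌊5 / 4 * C⌋₊).filter (fun c => r.Coprime c),
          ∑ h ∈ block H₀ j, ((wt C D ξ c h : ℝ) : ℂ) * kl c r n (sgn * h)) =
      fun ξ : ℝ => ∑ r ∈ dyadic R, ∑ n ∈ Finset.Icc 1 N,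
        ∑ c ∈ (Finset.Icc 1 ⌊5 / 4 * C⌋₊).filter (fun c => r.Coprime c), ∑ h ∈ block H₀ j,
          B n r 1 * (((𝐞 (-(sgn * ξ)) : Circle) : ℂ) * (((wt C D ξ c h : ℝ) : ℂ) * kl c r n (sgn * h))) by
    funext ξ
    simp only [Finset.mul_sum]
    refine Finset.sum_congr rfl fun r _ => Finset.sum_congr rfl fun n _ =>
      Finset.sum_congr rfl fun c _ => Finset.sum_congr rfl fun h _ => ?_
    ring]
  have hint : ∀ r ∈ dyadic R, ∀ n ∈ Finset.Icc 1 N,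
      ∀ c ∈ (Finset.Icc 1 ⌊5 / 4 * C⌋₊).filter (fun c => r.Coprime c), ∀ h ∈ block H₀ j,
      Integrable fun ξ : ℝ => B n r 1 * (((𝐞 (-(sgn * ξ)) : Circle) : ℂ) *
        (((wt C D ξ c h : ℝ) : ℂ) * kl c r n (sgn * h))) := by
    intro r hr n _ c hc h hh
    have := (integrable_term (C := C) hD (hR0 r hr c hc) (hh0 h hh) (-sgn) (kl c r n (sgn * h))).const_mul
      (B n r 1)
    refine this.congr (Filter.Eventually.of_forall fun ξ => ?_)
    simp only [neg_mul]
  rw [integral_finsetSum _ fun r hr => ?_]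
  · refine Finset.sum_congr rfl fun r hr => ?_
    rw [integral_finsetSum _ fun n hn => ?_]
    · refine Finset.sum_congr rfl fun n hn => ?_
      rw [Finset.mul_sum, integral_finsetSum _ fun c hc => ?_]
      · refine Finset.sum_congr rfl fun c hc => ?_
        rw [Finset.mul_sum, integral_finsetSum _ fun h hh => hint r hr n hn c hc h hh]
        refine Finset.sum_congr rfl fun h hh => ?_
        rw [integral_const_mul, term r n c h (hR0 r hr c hc) (hh0 h hh)]
      · exact integrable_finsetSum _ fun h hh => hint r hr n hn c hc h hh
    · exact integrable_finsetSum _ fun c hc => integrable_finsetSum _ fun h hh => hint r hr n hn c hc h hh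
  · exact integrable_finsetSum _ fun n hn => integrable_finsetSum _ fun c hc =>
      integrable_finsetSum _ fun h hh => hint r hr n hn c hc h hh



/-! ### The block integrand vanishes outside `Ξ_j = [2^j D/(5C), 10 · 2^j D/C]` -/

/-- `w(c/C) ≠ 0` forces `C/4 < c < 5C/4` (`C > 0`). [folklore] -/
theorem bounds_of_plateau1_ne_zero {C c : ℝ} (hC : 0 < C) (h : plateau1 (c / C) ≠ 0) :
    C / 4 < c ∧ c < 5 / 4 * C := by
  constructor
  · by_contra hle
    rw [not_lt] at hle
    exact h (plateau_eq_zero_of_le (by rw [div_le_iff₀ hC]; linarith))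
  · by_contra hle
    rw [not_lt] at hle
    exact h (plateau_eq_zero_of_ge (by rw [le_div_iff₀ hC]; linarith))

/-- The weight `h⁻¹ w(c/C) w(ξc/(hD))` vanishes for `ξ ∉ [2^j D/(5C), 10·2^j D/C]` when
`2^j ≤ h < 2^{j+1}` (`C, D > 0`). [folklore] -/
theorem wt_eq_zero {C D ξ : ℝ} (hC : 0 < C) (hD : 0 < D) {j : ℕ} {c h : ℕ}
    (hh : (2 : ℝ) ^ j ≤ h ∧ (h : ℝ) < 2 * 2 ^ j)
    (hξ : ξ ∉ Set.Icc ((2 : ℝ) ^ j * D / (5 * C)) (10 * 2 ^ j * D / C)) : wt C D ξ c h = 0 := by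
  unfold wt
  by_cases hw : plateau1 (c / C) = 0
  · rw [hw, zero_mul, mul_zero]
  obtain ⟨hc1, hc2⟩ := bounds_of_plateau1_ne_zero hC hw
  have h2j : (0 : ℝ) < 2 ^ j := by positivity
  have hhpos : (0 : ℝ) < h := lt_of_lt_of_le h2j hh.1
  have hhD : 0 < (h : ℝ) * D := by positivity
  suffices hw2 : plateau1 (ξ * c / (h * D)) = 0 by rw [hw2, mul_zero, mul_zero]
  rw [Set.mem_Icc, not_and_or, not_le, not_le] at hξ
  rcases hξ with hξ | hξ
  · refine plateau_eq_zero_of_le ?_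
    rw [div_le_iff₀ hhD]
    rcases le_or_gt ξ 0 with h0 | h0
    · nlinarith [mul_nonpos_of_nonpos_of_nonneg h0 (le_of_lt (lt_trans (by positivity) hc1))]
    · -- `ξ c < (2^j D/(5C)) (5C/4) = 2^j D/4 ≤ h D/4`
      have h1 : ξ * c < 2 ^ j * D / (5 * C) * (5 / 4 * C) :=
        mul_lt_mul'' hξ hc2 h0.le (by linarith)
      have h2 : 2 ^ j * D / (5 * C) * (5 / 4 * C) = 2 ^ j * D / 4 := by field_simp
      rw [h2] at h1
      nlinarith [hh.1, hD]
  · refine plateau_eq_zero_of_ge ?_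
    rw [le_div_iff₀ hhD]
    -- `ξ c > (10 · 2^j D/C)(C/4) = (5/2) 2^j D ≥ (5/4) h D`
    have h0 : 0 < ξ := lt_trans (by positivity) hξ
    have h1 : 10 * 2 ^ j * D / C * (C / 4) < ξ * c := mul_lt_mul'' hξ hc1 (by positivity) (by positivity)
    have h2 : 10 * 2 ^ j * D / C * (C / 4) = 5 / 2 * 2 ^ j * D := by field_simp; ring
    rw [h2] at h1
    nlinarith [hh.2, hD]

/-- **The block integrand vanishes outside `Ξ_j`.** [cite: DeshouillersIwaniec1982, §9.2 (9.13) p. 281] -/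
theorem Wfun_eq_zero {C D : ℝ} (hC : 0 < C) (hD : 0 < D) (N : ℕ) (R : ℝ) (H₀ : ℕ)
    (B : ℕ → ℕ → ℕ → ℂ) (j : ℕ) (sgn : ℤ) {ξ : ℝ}
    (hξ : ξ ∉ Set.Icc ((2 : ℝ) ^ j * D / (5 * C)) (10 * 2 ^ j * D / C)) :
    Wfun C D N R H₀ B j sgn ξ = 0 := by
  unfold Wfun
  refine Finset.sum_eq_zero fun r _ => Finset.sum_eq_zero fun n _ => ?_
  rw [Finset.sum_eq_zero fun c _ => ?_, mul_zero]
  refine Finset.sum_eq_zero fun h hh => ?_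
  have hb := block_bounds hh
  rw [wt_eq_zero hC hD ⟨hb.1, hb.2.1⟩ hξ, Complex.ofReal_zero, zero_mul]

/-! ### On `Ξ_j` the block integrand is a combination of Deshouillers–Iwaniec sums -/

/-- `G_i` at the dilated point: `G_i(c/(a_i C), y) = π_i(c/C) y⁻¹ w((c/(a_iC))/y)`. [folklore] -/
theorem Gw_apply_div (i : ℕ) {C : ℝ} (hC : 0 < C) (c y : ℝ) :
    Gw i (c / (pa i * C), y) = piece i (c / C) * (y⁻¹ * plateau1 (c / (pa i * C) / y)) := by
  unfold Gw
  have ha := pa_pos i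
  congr 2
  field_simp

/-- `G_i(c/(a_iC), y) = 0` once `c ≥ 5C/4` or `c ≥ 2a_iC`. [folklore] -/
theorem Gw_div_eq_zero (i : ℕ) {C : ℝ} (hC : 0 < C) {c : ℝ} (hc : 5 / 4 * C ≤ c ∨ 2 * (pa i * C) ≤ c)
    (y : ℝ) : Gw i (c / (pa i * C), y) = 0 := by
  have ha := pa_pos i
  rcases hc with hc | hc
  · rw [Gw_apply_div i hC, piece_eq_zero_of_ge' i (by rw [le_div_iff₀ hC]; linarith), zero_mul]
  · exact Gw_eq_zero_of_fst i (Or.inr (by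
      show (2 : ℝ) ≤ c / (pa i * C)
      rw [le_div_iff₀ (by positivity)]; linarith))

/-- Changing the cut-off of the `c`-sum when the summand vanishes beyond both cut-offs. [folklore] -/
theorem sum_filter_Icc_eq_of_vanish {A A' : ℕ} (p : ℕ → Prop) [DecidablePred p] (f : ℕ → ℂ)
    (hA : ∀ c, A < c → f c = 0) (hA' : ∀ c, A' < c → f c = 0) :
    ∑ c ∈ (Finset.Icc 1 A).filter p, f c = ∑ c ∈ (Finset.Icc 1 A').filter p, f c := by
  have key : ∀ {X Y : ℕ}, X ≤ Y → (∀ c, X < c → f c = 0) →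
      ∑ c ∈ (Finset.Icc 1 X).filter p, f c = ∑ c ∈ (Finset.Icc 1 Y).filter p, f c := by
    intro X Y hXY hX
    refine Finset.sum_subset (Finset.filter_subset_filter _ (Finset.Icc_subset_Icc le_rfl hXY)) ?_
    intro c hc hc'
    rw [Finset.mem_filter, Finset.mem_Icc] at hc hc'
    refine hX c ?_
    by_contra hle
    exact hc' ⟨⟨hc.1.1, not_lt.1 hle⟩, hc.2⟩
  rw [key (le_max_left A A') hA, key (le_max_right A A') hA']

/-- **On `ξ > 0` the block integrand is `∑_i (M'_i)⁻¹ 𝒯_i`**, `𝒯_i` the Deshouillers–Iwaniec sum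
for the master weight `G_i` at the scales `C_i = a_i C`, `M'_i = ξ a_i C/D`, over the block
`[2^j, min(H₀, 2^{j+1} − 1)]`. [cite: DeshouillersIwaniec1982, §9.2 p. 281] -/
theorem Wfun_eq_sum_diSum {C D : ℝ} (hC : 0 < C) (hD : 0 < D) (N : ℕ) (R : ℝ) (H₀ : ℕ)
    (B : ℕ → ℕ → ℕ → ℂ) (j : ℕ) (sgn : ℤ) {ξ : ℝ} (hξ : 0 < ξ) :
    Wfun C D N R H₀ B j sgn ξ =
      ∑ i ∈ Finset.range 3, (((ξ * (pa i * C) / D)⁻¹ : ℝ) : ℂ) *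
        diSum (Gw i) (pa i * C) (ξ * (pa i * C) / D) N R (2 ^ j) (min H₀ (2 ^ (j + 1) - 1)) sgn
          (fun n r => B n r 1) := by
  -- expand the weight termwise
  have hwt : ∀ (c h : ℕ), 0 < h → ((wt C D ξ c h : ℝ) : ℂ) =
      ∑ i ∈ Finset.range 3, (((ξ * (pa i * C) / D)⁻¹ *
        Gw i ((c : ℝ) / (pa i * C), (h : ℝ) / (ξ * (pa i * C) / D)) : ℝ) : ℂ) := by
    intro c h hh
    have hh' : (h : ℝ) ≠ 0 := by exact_mod_cast hh.ne'
    unfold wt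
    rw [← sum_piece ((c : ℝ) / C), Finset.sum_mul, Finset.mul_sum]
    push_cast
    refine Finset.sum_congr rfl fun i _ => ?_
    have e := congrArg (fun x : ℝ => (x : ℂ)) (Gw_dilate i hC hD hξ hh' (c : ℝ))
    push_cast at e
    exact e.symm
  unfold Wfun diSum
  -- rewrite each term and move the `i`-sum outside
  have step : ∀ r ∈ dyadic R, ∀ n ∈ Finset.Icc 1 N,
      B n r 1 * ∑ c ∈ (Finset.Icc 1 ⌊5 / 4 * C⌋₊).filter (fun c => r.Coprime c),
        ∑ h ∈ block H₀ j, ((wt C D ξ c h : ℝ) : ℂ) * kl c r n (sgn * h) =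
      ∑ i ∈ Finset.range 3, (((ξ * (pa i * C) / D)⁻¹ : ℝ) : ℂ) * (B n r 1 *
        ∑ m ∈ Finset.Icc (2 ^ j) (min H₀ (2 ^ (j + 1) - 1)),
          ∑ c ∈ (Finset.Icc 1 ⌊2 * (pa i * C)⌋₊).filter (fun c => r.Coprime c),
            ((Gw i ((c : ℝ) / (pa i * C), (m : ℝ) / (ξ * (pa i * C) / D)) : ℝ) : ℂ) *
              kl c r n (sgn * m)) := by
    intro r _ n _
    -- `c`-cut-off change and the order of `c, h`
    have hcut : ∀ i ∈ Finset.range 3, ∀ m : ℕ,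
        ∑ c ∈ (Finset.Icc 1 ⌊5 / 4 * C⌋₊).filter (fun c => r.Coprime c),
          ((Gw i ((c : ℝ) / (pa i * C), (m : ℝ) / (ξ * (pa i * C) / D)) : ℝ) : ℂ) * kl c r n (sgn * m) =
        ∑ c ∈ (Finset.Icc 1 ⌊2 * (pa i * C)⌋₊).filter (fun c => r.Coprime c),
          ((Gw i ((c : ℝ) / (pa i * C), (m : ℝ) / (ξ * (pa i * C) / D)) : ℝ) : ℂ) * kl c r n (sgn * m) := by
      intro i _ m
      refine sum_filter_Icc_eq_of_vanish _ _ (fun c hc => ?_) (fun c hc => ?_)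
      · rw [Gw_div_eq_zero i hC (Or.inl (Nat.lt_of_floor_lt hc).le), Complex.ofReal_zero, zero_mul]
      · rw [Gw_div_eq_zero i hC (Or.inr (Nat.lt_of_floor_lt hc).le), Complex.ofReal_zero, zero_mul]
    calc B n r 1 * ∑ c ∈ (Finset.Icc 1 ⌊5 / 4 * C⌋₊).filter (fun c => r.Coprime c),
          ∑ h ∈ block H₀ j, ((wt C D ξ c h : ℝ) : ℂ) * kl c r n (sgn * h)
        = B n r 1 * ∑ c ∈ (Finset.Icc 1 ⌊5 / 4 * C⌋₊).filter (fun c => r.Coprime c),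
            ∑ h ∈ block H₀ j, ∑ i ∈ Finset.range 3, (((ξ * (pa i * C) / D)⁻¹ : ℝ) : ℂ) *
              (((Gw i ((c : ℝ) / (pa i * C), (h : ℝ) / (ξ * (pa i * C) / D)) : ℝ) : ℂ) *
                kl c r n (sgn * h)) := by
          congr 1
          refine Finset.sum_congr rfl fun c _ => Finset.sum_congr rfl fun h hh => ?_
          rw [hwt c h (block_bounds hh).2.2.1, Finset.sum_mul]
          refine Finset.sum_congr rfl fun i _ => ?_
          push_cast
          ring
      _ = ∑ i ∈ Finset.range 3, (((ξ * (pa i * C) / D)⁻¹ : ℝ) : ℂ) * (B n r 1 *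
            ∑ c ∈ (Finset.Icc 1 ⌊5 / 4 * C⌋₊).filter (fun c => r.Coprime c),
              ∑ h ∈ block H₀ j,
                (((Gw i ((c : ℝ) / (pa i * C), (h : ℝ) / (ξ * (pa i * C) / D)) : ℝ) : ℂ) *
                  kl c r n (sgn * h))) := by
          rw [Finset.sum_congr rfl fun c _ => Finset.sum_comm, Finset.sum_comm, Finset.mul_sum]
          refine Finset.sum_congr rfl fun i _ => ?_
          rw [Finset.mul_sum, Finset.mul_sum, Finset.mul_sum]
          refine Finset.sum_congr rfl fun c _ => ?_
          rw [Finset.mul_sum, Finset.mul_sum, Finset.mul_sum]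
          refine Finset.sum_congr rfl fun h _ => ?_
          ring
      _ = _ := by
          refine Finset.sum_congr rfl fun i hi => ?_
          congr 2
          rw [Finset.sum_comm]
          unfold block
          refine Finset.sum_congr rfl fun m _ => hcut i hi m
  rw [Finset.sum_congr rfl fun r hr => Finset.sum_congr rfl fun n hn => step r hr n hn]
  rw [Finset.sum_congr rfl fun r _ => Finset.sum_comm, Finset.sum_comm]
  refine Finset.sum_congr rfl fun i _ => ?_
  rw [Finset.mul_sum]
  refine Finset.sum_congr rfl fun r _ => ?_
  rw [Finset.mul_sum]



/-! ### The quantity `L`: a monotone majorant and the range computation (9.14) -/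

/-- A monotone majorant `Λ ≥ L²`:
`Λ(C, M, N, R) = (R/2)(C²R/4 + MN + C²N/2 + C²M/2 + C²NM/R) + (C³/4)√((R/2 + N)R)` (Drappeau's
simplification `L_reg² ≪ RS(C²S²R + MN + C²MN/R + C²S(M + N))` at `S = 1/2`). [folklore] -/
def Lam (C M N R : ℝ) : ℝ :=
  R * (1 / 2) * (C ^ 2 * (1 / 2) ^ 2 * R + M * N + C ^ 2 * (1 / 2) * N + C ^ 2 * (1 / 2) * M +
      C ^ 2 * N * M / R) +
    C ^ 3 * (1 / 2) ^ 2 * Real.sqrt ((R * (1 / 2) + N) * R)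

/-- `Λ ≥ 0`. [folklore] -/
theorem Lam_nonneg {C M N R : ℝ} (hC : 0 ≤ C) (hM : 0 ≤ M) (hN : 0 ≤ N) (hR : 0 ≤ R) :
    0 ≤ Lam C M N R := by
  unfold Lam; positivity

/-- `L² ≤ Λ`. [folklore] -/
theorem diL_sq_le_Lam {C M N R : ℝ} (hC : 0 < C) (hM : 0 ≤ M) (hN : 0 ≤ N) (hR : 0 < R) :
    diL C M N R ^ 2 ≤ Lam C M N R := by
  unfold diL Lam
  set A : ℝ := C ^ 2 * (1 / 2) ^ 2 * R with hA
  set b : ℝ := C ^ 2 * (1 / 2) with hb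
  set u : ℝ := A + M * N with hu
  have hA0 : 0 < A := by positivity
  have hb0 : 0 ≤ b := by positivity
  have hu0 : 0 < u := by positivity
  have hAu : A ≤ u := by rw [hu]; nlinarith
  have hsq : R * (N + R * (1 / 2)) = (R * (1 / 2) + N) * R := by ring
  have hf : (A + M * N + b * N) * (A + M * N + b * M) / (A + M * N) ≤
      A + M * N + b * N + b * M + C ^ 2 * N * M / R := by
    have e1 : (A + M * N + b * N) * (A + M * N + b * M) / (A + M * N) =
        A + M * N + b * N + b * M + b ^ 2 * N * M / u := by
      rw [← hu]; field_simp; ring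
    have e2 : C ^ 2 * N * M / R = b ^ 2 * N * M / A := by
      rw [hb, hA]; field_simp
    rw [e1, e2]
    gcongr
  have hX : 0 ≤ R * (1 / 2) * ((A + M * N + b * N) * (A + M * N + b * M) / (A + M * N)) +
      C ^ 3 * (1 / 2) ^ 2 * Real.sqrt (R * (N + R * (1 / 2))) := by positivity
  rw [Real.sq_sqrt hX, hsq]
  have : R * (1 / 2) * ((A + M * N + b * N) * (A + M * N + b * M) / (A + M * N)) ≤
      R * (1 / 2) * (A + M * N + b * N + b * M + C ^ 2 * N * M / R) :=
    mul_le_mul_of_nonneg_left hf (by positivity)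
  linarith

/-- `Λ` is monotone in `C` and `M`. [folklore] -/
theorem Lam_mono {C C' M M' N R : ℝ} (hC : 0 ≤ C) (hCC : C ≤ C') (hM : 0 ≤ M) (hMM : M ≤ M')
    (hN : 0 ≤ N) (hR : 0 < R) : Lam C M N R ≤ Lam C' M' N R := by
  unfold Lam
  have hC2 : C ^ 2 ≤ C' ^ 2 := pow_le_pow_left₀ hC hCC 2
  have hC3 : C ^ 3 ≤ C' ^ 3 := pow_le_pow_left₀ hC hCC 3
  have hs : 0 ≤ Real.sqrt ((R * (1 / 2) + N) * R) := Real.sqrt_nonneg _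
  gcongr

/-- `L(C, M, N, R) ≤ √Λ(C', M', N, R)` for `C ≤ C'`, `M ≤ M'`. [folklore] -/
theorem diL_le_sqrt_Lam {C C' M M' N R : ℝ} (hC : 0 < C) (hCC : C ≤ C') (hM : 0 ≤ M) (hMM : M ≤ M')
    (hN : 0 ≤ N) (hR : 0 < R) : diL C M N R ≤ Real.sqrt (Lam C' M' N R) := by
  rw [← Real.sqrt_sq (diL_nonneg C M N R)]
  exact Real.sqrt_le_sqrt ((diL_sq_le_Lam hC hM hN hR).trans (Lam_mono hC.le hCC hM hMM hN hR))

/-- **The range computation (9.14) at `S = 1/2`**: for `M ≥ 1` with `M ≤ λ C/D`,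
`(D/C)² M Λ(C, 10M, N, R) ≤ 11 max(1, λ)² 𝓚²`, `𝓚² = C·½·(R/2 + N)(C + DR) + C²D·½·√((R/2+N)R)`
(the first two terms of the corrected `𝓘²`). [cite: DeshouillersIwaniec1982, §9.2 (9.14) p. 282] -/
theorem range_bound {C D N R M lam : ℝ} (hC : 1 ≤ C) (hD : 1 ≤ D) (hN : 1 ≤ N) (hR : 1 / 2 ≤ R)
    (hM : 0 ≤ M) (hMl : M ≤ lam * C / D) :
    (D / C) ^ 2 * M * Lam C (10 * M) N R ≤
      11 * max 1 lam ^ 2 * (C * (1 / 2) * (R * (1 / 2) + N) * (C + D * R) +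
        C ^ 2 * D * (1 / 2) * Real.sqrt ((R * (1 / 2) + N) * R)) := by
  set μ : ℝ := max 1 lam with hμ
  set s : ℝ := Real.sqrt ((R * (1 / 2) + N) * R) with hs
  have hμ1 : 1 ≤ μ := le_max_left _ _
  have hlμ : lam ≤ μ := le_max_right _ _
  have hμ0 : 0 ≤ μ := le_trans zero_le_one hμ1
  have hC0 : 0 < C := by linarith
  have hD0 : 0 < D := by linarith
  have hR0 : 0 < R := by linarith
  have hN0 : 0 < N := by linarith
  have hs0 : 0 ≤ s := Real.sqrt_nonneg _
  set X : ℝ := D * M with hX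
  have hX0 : 0 ≤ X := by positivity
  have hXμ : X ≤ μ * C := by
    have h1 : D * M ≤ D * (lam * C / D) := mul_le_mul_of_nonneg_left hMl hD0.le
    rw [mul_div_cancel₀ _ hD0.ne'] at h1
    calc X = D * M := hX
      _ ≤ lam * C := h1
      _ ≤ μ * C := mul_le_mul_of_nonneg_right hlμ hC0.le
  have hμμ : μ ≤ μ ^ 2 := by nlinarith
  have hX1 : X ≤ μ ^ 2 * C := hXμ.trans (mul_le_mul_of_nonneg_right hμμ hC0.le)
  have hX2 : X ^ 2 ≤ μ ^ 2 * C ^ 2 := by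
    calc X ^ 2 ≤ (μ * C) ^ 2 := pow_le_pow_left₀ hX0 hXμ 2
      _ = μ ^ 2 * C ^ 2 := by ring
  -- atoms
  set P1 : ℝ := μ ^ 2 * (C * D * R ^ 2) with hP1
  set P2 : ℝ := μ ^ 2 * (C * D * N * R) with hP2
  set P3 : ℝ := μ ^ 2 * (C ^ 2 * R) with hP3
  set P4 : ℝ := μ ^ 2 * (C ^ 2 * N) with hP4
  set P5 : ℝ := μ ^ 2 * (C ^ 2 * D * s) with hP5
  have hP1' : 0 ≤ P1 := by positivity
  have hP2' : 0 ≤ P2 := by positivity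
  have hP3' : 0 ≤ P3 := by positivity
  have hP4' : 0 ≤ P4 := by positivity
  have hP5' : 0 ≤ P5 := by positivity
  -- expansion of the left side
  have e : (D / C) ^ 2 * M * Lam C (10 * M) N R =
      X * D * R ^ 2 / 8 + 5 * X ^ 2 * N * R / C ^ 2 + X * D * N * R / 4 +
        5 / 2 * X ^ 2 * R + 5 * X ^ 2 * N + X * D * C * s / 4 := by
    unfold Lam
    rw [← hs, hX]
    field_simp
    ring
  rw [e]
  have t1 : X * D * R ^ 2 / 8 ≤ P1 / 8 := by
    have : X * D * R ^ 2 ≤ (μ ^ 2 * C) * D * R ^ 2 := by gcongr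
    rw [hP1]; linarith
  have t2 : 5 * X ^ 2 * N * R / C ^ 2 ≤ 5 * P2 := by
    have h1 : 5 * X ^ 2 * N * R / C ^ 2 ≤ 5 * (μ ^ 2 * C ^ 2) * N * R / C ^ 2 := by gcongr
    have h2 : 5 * (μ ^ 2 * C ^ 2) * N * R / C ^ 2 = 5 * (μ ^ 2 * (N * R)) := by field_simp
    have h3 : N * R ≤ C * D * N * R := by
      have : (1:ℝ) ≤ C * D := by nlinarith
      have hNR : 0 < N * R := mul_pos hN0 hR0
      nlinarith
    have h4 : μ ^ 2 * (N * R) ≤ μ ^ 2 * (C * D * N * R) := mul_le_mul_of_nonneg_left h3 (sq_nonneg μ)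
    rw [hP2]; linarith
  have t3 : X * D * N * R / 4 ≤ P2 / 4 := by
    have : X * D * N * R ≤ (μ ^ 2 * C) * D * N * R := by gcongr
    rw [hP2]; linarith
  have t4 : 5 / 2 * X ^ 2 * R ≤ 5 / 2 * P3 := by
    have : X ^ 2 * R ≤ (μ ^ 2 * C ^ 2) * R := by gcongr
    rw [hP3]; linarith
  have t5 : 5 * X ^ 2 * N ≤ 5 * P4 := by
    have : X ^ 2 * N ≤ (μ ^ 2 * C ^ 2) * N := by gcongr
    rw [hP4]; linarith
  have t6 : X * D * C * s / 4 ≤ P5 / 4 := by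
    have : X * D * C * s ≤ (μ ^ 2 * C) * D * C * s := by gcongr
    rw [hP5]; linarith
  have hT : 11 * μ ^ 2 * (C * (1 / 2) * (R * (1 / 2) + N) * (C + D * R) + C ^ 2 * D * (1 / 2) * s) =
      11 / 4 * P3 + 11 / 4 * P1 + 11 / 2 * P4 + 11 / 2 * P2 + 11 / 2 * P5 := by
    rw [hP1, hP2, hP3, hP4, hP5]; ring
  rw [hT]
  linarith


/-! ### The bulk blocks: Theorem 11 on `Ξ_j` -/

/-- The `ℓ²`-norm of `b_{nr} = B_{nr1}`. [folklore] -/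
def nb (N : ℕ) (R : ℝ) (B : ℕ → ℕ → ℕ → ℂ) : ℝ :=
  Real.sqrt (∑ r ∈ dyadic R, ∑ n ∈ Finset.Icc 1 N, ‖B n r 1‖ ^ 2)

/-- `‖b‖ ≥ 0`. [folklore] -/
theorem nb_nonneg (N : ℕ) (R : ℝ) (B : ℕ → ℕ → ℕ → ℂ) : 0 ≤ nb N R B := Real.sqrt_nonneg _

/-- At `S = 1/2`, `‖B‖ = ‖b‖`. [folklore] -/
theorem lemma1Norm_half (N : ℕ) (R : ℝ) (B : ℕ → ℕ → ℕ → ℂ) : lemma1Norm N R (1 / 2) B = nb N R B := by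
  unfold lemma1Norm nb
  rw [L6.dyadic_half]
  simp only [Finset.sum_singleton]

/-- **The bulk block bound**: if Theorem 11 holds for the three master weights at `ε₁` with constant
`K` (at the given `N, R`), then for every block `j` and sign,
`‖blockSum_j‖ ≤ (10·2^j D/C) · 3K (10 C 2^j N R)^{ε₁} Λ(C, 10·2^j, N, R)^{1/2} (20/2^j)^{1/2} ‖b‖`.
[cite: DeshouillersIwaniec1982, §9.2 pp. 281–282] -/
theorem norm_blockSum_le_bulk {C D N R : ℝ} (hC : 1 ≤ C) (hD : 1 ≤ D) (hN : 1 ≤ N) (hR : 1 / 2 ≤ R)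
    {ε₁ K : ℝ} (hε₁ : 0 < ε₁) (hK0 : 0 ≤ K)
    (hK : ∀ i ∈ Finset.range 3, ∀ C' M' : ℝ, 0 < C' → 0 < M' → ∀ b : ℕ → ℕ → ℂ, ∀ m₁ m₂ : ℕ,
      1 ≤ m₁ → ∀ sgn : ℤ, (sgn = 1 ∨ sgn = -1) →
        ‖diSum (Gw i) C' M' ⌊N⌋₊ R m₁ m₂ sgn b‖ ≤
          K * (C' * M' * N * R) ^ ε₁ * diL C' M' N R * Real.sqrt M' *
            Real.sqrt (∑ r ∈ dyadic R, ∑ n ∈ Finset.Icc 1 ⌊N⌋₊, ‖b n r‖ ^ 2))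
    (H₀ : ℕ) (B : ℕ → ℕ → ℕ → ℂ) (j : ℕ) {sgn : ℤ} (hs : sgn = 1 ∨ sgn = -1) :
    ‖blockSum C D ⌊N⌋₊ R H₀ B j sgn‖ ≤
      (10 * 2 ^ j * D / C) * (3 * (K * (10 * C * 2 ^ j * N * R) ^ ε₁ *
        Real.sqrt (Lam C (10 * 2 ^ j) N R) * Real.sqrt (20 / 2 ^ j) * nb ⌊N⌋₊ R B)) := by
  have hC0 : 0 < C := by linarith
  have hD0 : 0 < D := by linarith
  have hR0 : 0 < R := by linarith
  have hN0 : 0 < N := by linarith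
  have h2j : (0 : ℝ) < 2 ^ j := by positivity
  set lo : ℝ := 2 ^ j * D / (5 * C) with hlo
  set hi : ℝ := 10 * 2 ^ j * D / C with hhi
  have hlo0 : 0 < lo := by positivity
  have hhi0 : 0 < hi := by positivity
  set Bnd : ℝ := 3 * (K * (10 * C * 2 ^ j * N * R) ^ ε₁ *
    Real.sqrt (Lam C (10 * 2 ^ j) N R) * Real.sqrt (20 / 2 ^ j) * nb ⌊N⌋₊ R B) with hBnd
  have hBnd0 : 0 ≤ Bnd := by have := nb_nonneg ⌊N⌋₊ R B; positivity
  rw [blockSum_eq_integral hD0 ⌊N⌋₊ R H₀ B j hs]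
  have hzero : ∀ ξ ∉ Set.Icc lo hi,
      ((𝐞 (-(sgn * ξ)) : Circle) : ℂ) * Wfun C D ⌊N⌋₊ R H₀ B j sgn ξ = 0 := by
    intro ξ hξ
    rw [Wfun_eq_zero hC0 hD0 ⌊N⌋₊ R H₀ B j sgn hξ, mul_zero]
  rw [← setIntegral_eq_integral_of_forall_compl_eq_zero hzero]
  -- pointwise bound on `Ξ_j`
  have hpt : ∀ ξ ∈ Set.Icc lo hi,
      ‖((𝐞 (-(sgn * ξ)) : Circle) : ℂ) * Wfun C D ⌊N⌋₊ R H₀ B j sgn ξ‖ ≤ Bnd := by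
    intro ξ hξ
    rw [Set.mem_Icc] at hξ
    have hξ0 : 0 < ξ := lt_of_lt_of_le hlo0 hξ.1
    rw [norm_mul, Circle.norm_coe, one_mul, Wfun_eq_sum_diSum hC0 hD0 ⌊N⌋₊ R H₀ B j sgn hξ0]
    refine (norm_sum_le _ _).trans ?_
    have hterm : ∀ i ∈ Finset.range 3,
        ‖(((ξ * (pa i * C) / D)⁻¹ : ℝ) : ℂ) *
          diSum (Gw i) (pa i * C) (ξ * (pa i * C) / D) ⌊N⌋₊ R (2 ^ j) (min H₀ (2 ^ (j + 1) - 1)) sgn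
            (fun n r => B n r 1)‖ ≤
        K * (10 * C * 2 ^ j * N * R) ^ ε₁ * Real.sqrt (Lam C (10 * 2 ^ j) N R) *
          Real.sqrt (20 / 2 ^ j) * nb ⌊N⌋₊ R B := by
      intro i hi3
      have ha : 0 < pa i := pa_pos i
      have ha1 : pa i ≤ 1 := pa_le_one i
      set C' : ℝ := pa i * C with hC'
      set M' : ℝ := ξ * (pa i * C) / D with hM'
      have hC'0 : 0 < C' := by positivity
      have hM'0 : 0 < M' := by positivity
      have hC'C : C' ≤ C := by rw [hC']; nlinarith
      -- `M' ∈ [2^j/20, 10·2^j]`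
      have hM'lo : 2 ^ j / 20 ≤ M' := by
        have h1 : lo * (pa i * C) / D ≤ M' := by
          rw [hM']; gcongr; exact hξ.1
        have h2 : lo * (pa i * C) / D = 2 ^ j * pa i / 5 := by rw [hlo]; field_simp
        rw [h2] at h1
        have h3 : 2 ^ j / 20 ≤ 2 ^ j * pa i / 5 := by
          have := quarter_le_pa i
          rw [div_le_div_iff₀ (by norm_num) (by norm_num)]
          nlinarith
        linarith
      have hM'hi : M' ≤ 10 * 2 ^ j := by
        have h1 : M' ≤ hi * (pa i * C) / D := by
          rw [hM']; gcongr; exact hξ.2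
        have h2 : hi * (pa i * C) / D = 10 * 2 ^ j * pa i := by rw [hhi]; field_simp
        rw [h2] at h1
        nlinarith
      have hkey := hK i hi3 C' M' hC'0 hM'0 (fun n r => B n r 1) (2 ^ j) (min H₀ (2 ^ (j + 1) - 1))
        Nat.one_le_two_pow sgn hs
      rw [norm_mul, Complex.norm_real, Real.norm_of_nonneg (inv_nonneg.2 hM'0.le)]
      refine (mul_le_mul_of_nonneg_left hkey (inv_nonneg.2 hM'0.le)).trans ?_
      -- compare factor by factor
      have f1 : (C' * M' * N * R) ^ ε₁ ≤ (10 * C * 2 ^ j * N * R) ^ ε₁ := by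
        refine Real.rpow_le_rpow (by positivity) ?_ hε₁.le
        have : C' * M' ≤ C * (10 * 2 ^ j) := mul_le_mul hC'C hM'hi hM'0.le hC0.le
        have hNR : 0 ≤ N * R := by positivity
        nlinarith
      have f2 : diL C' M' N R ≤ Real.sqrt (Lam C (10 * 2 ^ j) N R) :=
        diL_le_sqrt_Lam hC'0 hC'C hM'0.le hM'hi hN0.le hR0
      have f3 : M'⁻¹ * Real.sqrt M' ≤ Real.sqrt (20 / 2 ^ j) := by
        have e1 : M'⁻¹ * Real.sqrt M' = Real.sqrt (M'⁻¹) := by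
          rw [Real.sqrt_inv]
          field_simp
          rw [Real.sq_sqrt hM'0.le]
        rw [e1]
        refine Real.sqrt_le_sqrt ?_
        rw [inv_le_comm₀ hM'0 (by positivity), inv_div]
        exact hM'lo
      have hX0 : 0 ≤ (C' * M' * N * R) ^ ε₁ := Real.rpow_nonneg (by positivity) _
      have hd0 : 0 ≤ diL C' M' N R := diL_nonneg _ _ _ _
      have hnb := nb_nonneg ⌊N⌋₊ R B
      calc M'⁻¹ * (K * (C' * M' * N * R) ^ ε₁ * diL C' M' N R * Real.sqrt M' *
            Real.sqrt (∑ r ∈ dyadic R, ∑ n ∈ Finset.Icc 1 ⌊N⌋₊, ‖B n r 1‖ ^ 2))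
          = K * (C' * M' * N * R) ^ ε₁ * diL C' M' N R * (M'⁻¹ * Real.sqrt M') * nb ⌊N⌋₊ R B := by
            unfold nb; ring
        _ ≤ K * (10 * C * 2 ^ j * N * R) ^ ε₁ * Real.sqrt (Lam C (10 * 2 ^ j) N R) *
            Real.sqrt (20 / 2 ^ j) * nb ⌊N⌋₊ R B := by
            gcongr
    calc ∑ i ∈ Finset.range 3, ‖(((ξ * (pa i * C) / D)⁻¹ : ℝ) : ℂ) *
          diSum (Gw i) (pa i * C) (ξ * (pa i * C) / D) ⌊N⌋₊ R (2 ^ j) (min H₀ (2 ^ (j + 1) - 1)) sgn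
            (fun n r => B n r 1)‖
        ≤ ∑ i ∈ Finset.range 3, K * (10 * C * 2 ^ j * N * R) ^ ε₁ * Real.sqrt (Lam C (10 * 2 ^ j) N R) *
            Real.sqrt (20 / 2 ^ j) * nb ⌊N⌋₊ R B := Finset.sum_le_sum hterm
      _ = Bnd := by rw [Finset.sum_const, Finset.card_range, nsmul_eq_mul, hBnd]; push_cast; ring
  refine (norm_setIntegral_le_of_norm_le_const measure_Icc_lt_top hpt).trans ?_
  rw [Real.volume_real_Icc]
  have hmax : max (hi - lo) 0 ≤ hi := max_le (by linarith) hhi0.le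
  calc Bnd * max (hi - lo) 0 ≤ Bnd * hi := mul_le_mul_of_nonneg_left hmax hBnd0
    _ = hi * Bnd := mul_comm _ _
    _ = _ := by rw [hhi, hBnd]



/-- The bulk bound in the form used for the range computation:
`‖blockSum_j‖ ≤ 30√20 · K X^{ε₁} · √((D/C)² 2^j Λ(C, 10·2^j, N, R)) · ‖b‖`. [folklore] -/
theorem norm_blockSum_le_bulk' {C D N R : ℝ} (hC : 1 ≤ C) (hD : 1 ≤ D) (hN : 1 ≤ N) (hR : 1 / 2 ≤ R)
    {ε₁ K : ℝ} (hε₁ : 0 < ε₁) (hK0 : 0 ≤ K)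
    (hK : ∀ i ∈ Finset.range 3, ∀ C' M' : ℝ, 0 < C' → 0 < M' → ∀ b : ℕ → ℕ → ℂ, ∀ m₁ m₂ : ℕ,
      1 ≤ m₁ → ∀ sgn : ℤ, (sgn = 1 ∨ sgn = -1) →
        ‖diSum (Gw i) C' M' ⌊N⌋₊ R m₁ m₂ sgn b‖ ≤
          K * (C' * M' * N * R) ^ ε₁ * diL C' M' N R * Real.sqrt M' *
            Real.sqrt (∑ r ∈ dyadic R, ∑ n ∈ Finset.Icc 1 ⌊N⌋₊, ‖b n r‖ ^ 2))
    (H₀ : ℕ) (B : ℕ → ℕ → ℕ → ℂ) (j : ℕ) {sgn : ℤ} (hs : sgn = 1 ∨ sgn = -1) :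
    ‖blockSum C D ⌊N⌋₊ R H₀ B j sgn‖ ≤
      30 * Real.sqrt 20 * K * (10 * C * 2 ^ j * N * R) ^ ε₁ *
        Real.sqrt ((D / C) ^ 2 * 2 ^ j * Lam C (10 * 2 ^ j) N R) * nb ⌊N⌋₊ R B := by
  refine (norm_blockSum_le_bulk hC hD hN hR hε₁ hK0 hK H₀ B j hs).trans (le_of_eq ?_)
  have hC0 : 0 < C := by linarith
  have hD0 : 0 < D := by linarith
  have h2j : (0 : ℝ) < 2 ^ j := by positivity
  have hL : 0 ≤ Lam C (10 * 2 ^ j) N R := Lam_nonneg (by linarith) (by positivity) (by linarith) (by linarith)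
  have e1 : Real.sqrt ((D / C) ^ 2 * 2 ^ j * Lam C (10 * 2 ^ j) N R) =
      D / C * Real.sqrt (2 ^ j) * Real.sqrt (Lam C (10 * 2 ^ j) N R) := by
    rw [Real.sqrt_mul (by positivity), Real.sqrt_mul (by positivity), Real.sqrt_sq (by positivity)]
  have e2 : Real.sqrt (20 / 2 ^ j) = Real.sqrt 20 / Real.sqrt (2 ^ j) := Real.sqrt_div (by norm_num) _
  have h3 : Real.sqrt (2 ^ j) ≠ 0 := (Real.sqrt_pos.2 h2j).ne'
  have h6 : (2 : ℝ) ^ j / Real.sqrt (2 ^ j) = Real.sqrt (2 ^ j) := by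
    rw [div_eq_iff h3, Real.mul_self_sqrt h2j.le]
  rw [e1, e2]
  generalize (10 * C * 2 ^ j * N * R) ^ ε₁ = Xp
  generalize Real.sqrt (Lam C (10 * 2 ^ j) N R) = Lr
  rw [show 10 * 2 ^ j * D / C * (3 * (K * Xp * Lr * (Real.sqrt 20 / Real.sqrt (2 ^ j)) * nb ⌊N⌋₊ R B)) =
    30 * Real.sqrt 20 * K * Xp * (D / C * ((2 : ℝ) ^ j / Real.sqrt (2 ^ j)) * Lr) * nb ⌊N⌋₊ R B by ring, h6]

/-! ### The tail blocks: Fourier decay of `Φ_c(±h)` -/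

/-- **Fourier decay in the tail**: for `1 ≤ c ≤ 5C/4` and `h > λ C/D`,
`|Φ_c(±h)| ≤ K_n D λ^{−n}`. [folklore] -/
theorem norm_fcoef_tail {C D lam : ℝ} (hC : 0 < C) (hD : 0 < D) (hlam : 0 < lam) {n : ℕ} (hn : 1 ≤ n)
    {c h : ℕ} (hc1 : 1 ≤ c) (hc : (c : ℝ) ≤ 5 / 4 * C) (hh : lam * C / D < h) {sgn : ℤ}
    (hs : sgn = 1 ∨ sgn = -1) :
    ‖fcoef (D / 2) (D / 4) c (sgn * h)‖ ≤ derivConst n * D * (lam⁻¹) ^ n := by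
  have hc0 : (0 : ℝ) < c := by exact_mod_cast hc1
  have hh0 : (0 : ℝ) < h := lt_trans (by positivity) hh
  have hKn : 0 ≤ derivConst n := le_trans zero_le_one (one_le_derivConst n)
  set ξ₀ : ℝ := ((sgn * h : ℤ) : ℝ) / c with hξ₀
  have habs : |ξ₀| = h / c := by
    rw [hξ₀, abs_div, abs_of_pos hc0]
    congr 1
    rcases hs with rfl | rfl
    · push_cast; rw [one_mul, abs_of_pos hh0]
    · push_cast; rw [neg_one_mul, abs_neg, abs_of_pos hh0]
  have hξne : ξ₀ ≠ 0 := by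
    intro h0; rw [← abs_eq_zero, habs] at h0
    exact (div_pos hh0 hc0).ne' h0
  rw [fcoef_def]
  refine (norm_fourier_bumpC_le_of_ne_zero hn (by positivity : 0 < D / 4) (by positivity : 0 ≤ D / 2)
    hξne).trans ?_
  rw [habs]
  have hπ : π ≠ 0 := Real.pi_pos.ne'
  have e : 4 * derivConst n * (D / 4)⁻¹ ^ n * (D / 4) / (2 * π * (h / c)) ^ n =
      derivConst n * D * ((D / 4)⁻¹ / (2 * π * (h / c))) ^ n := by
    rw [div_pow]; ring
  have e0 : (D / 4)⁻¹ / (2 * π * ((h : ℝ) / c)) = 4 * c / (2 * π * h * D) := by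
    field_simp
  rw [e, e0]
  refine mul_le_mul_of_nonneg_left (pow_le_pow_left₀ (by positivity) ?_ n) (by positivity)
  -- `4c/(2π h D) ≤ 5C/(2π h D) < 5/(2πλ) ≤ 1/λ`
  have hπ3 : 3 < π := Real.pi_gt_three
  have hhD : lam * C < h * D := by rwa [div_lt_iff₀ hD] at hh
  rw [inv_eq_one_div, div_le_div_iff₀ (by positivity) hlam]
  nlinarith [mul_le_mul_of_nonneg_right hc hlam.le, mul_pos hh0 hD,
    mul_pos (by linarith : (0:ℝ) < π - 5 / 2) (mul_pos hh0 hD)]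

/-- The cardinality of a block is at most `H₀`. [folklore] -/
theorem card_block_le (H₀ j : ℕ) : (block H₀ j).card ≤ H₀ := by
  unfold block
  rw [Nat.card_Icc]
  have := @Nat.one_le_two_pow j
  omega

/-- **The tail block bound**: for `2^j > λ C/D`,
`‖blockSum_j‖ ≤ (∑_{r,n} |B_{nr1}|) · (5C/4) H₀ · K_n D λ^{−n}`. [folklore] -/
theorem norm_blockSum_le_tail {C D : ℝ} (hC : 1 ≤ C) (hD : 1 ≤ D) (N : ℕ) (R : ℝ) {lam : ℝ}
    (hlam : 0 < lam) {n : ℕ} (hn : 1 ≤ n) (H₀ : ℕ) (B : ℕ → ℕ → ℕ → ℂ) {j : ℕ}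
    (hj : lam * C / D < (2 : ℝ) ^ j) {sgn : ℤ} (hs : sgn = 1 ∨ sgn = -1) :
    ‖blockSum C D N R H₀ B j sgn‖ ≤
      (∑ r ∈ dyadic R, ∑ n ∈ Finset.Icc 1 N, ‖B n r 1‖) *
        ((5 / 4 * C) * H₀ * (derivConst n * D * (lam⁻¹) ^ n)) := by
  have hC0 : 0 < C := by linarith
  have hD0 : 0 < D := by linarith
  have hKn : 0 ≤ derivConst n := le_trans zero_le_one (one_le_derivConst n)
  set T : ℝ := derivConst n * D * (lam⁻¹) ^ n with hT
  have hT0 : 0 ≤ T := by positivity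
  unfold blockSum
  rw [Finset.sum_mul]
  refine (norm_sum_le _ _).trans (Finset.sum_le_sum fun r _ => ?_)
  rw [Finset.sum_mul]
  refine (norm_sum_le _ _).trans (Finset.sum_le_sum fun n' _ => ?_)
  rw [norm_mul]
  refine mul_le_mul_of_nonneg_left ?_ (norm_nonneg _)
  -- the `(c, h)`-sums
  have hterm : ∀ c ∈ (Finset.Icc 1 ⌊5 / 4 * C⌋₊).filter (fun c => r.Coprime c), ∀ h ∈ block H₀ j,
      ‖((plateau1 (c / C) : ℝ) : ℂ) * (((c : ℂ))⁻¹ * fcoef (D / 2) (D / 4) c (sgn * h)) *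
        kl c r n' (sgn * h)‖ ≤ T := by
    intro c hc h hh
    obtain ⟨hc1, hc2⟩ := Finset.mem_Icc.1 (Finset.mem_filter.1 hc).1
    have hcr : (c : ℝ) ≤ 5 / 4 * C := le_trans (by exact_mod_cast hc2) (Nat.floor_le (by positivity))
    have hc0 : (0 : ℝ) < c := by exact_mod_cast hc1
    have hb := block_bounds hh
    have hhl : lam * C / D < h := lt_of_lt_of_le hj hb.1
    rw [norm_mul, norm_mul, norm_mul, norm_inv, Complex.norm_real, Complex.norm_natCast,
      Real.norm_of_nonneg (plateau_nonneg _)]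
    have hf := norm_fcoef_tail hC0 hD0 hlam hn hc1 hcr hhl hs
    calc plateau1 (c / C) * ((c : ℝ)⁻¹ * ‖fcoef (D / 2) (D / 4) c (sgn * h)‖) * ‖kl c r n' (sgn * h)‖
        ≤ 1 * ((c : ℝ)⁻¹ * T) * c :=
          mul_le_mul (mul_le_mul (plateau_le_one _) (mul_le_mul_of_nonneg_left hf (inv_nonneg.2 hc0.le))
            (by positivity) zero_le_one) (norm_kl_le c r n' _) (norm_nonneg _) (by positivity)
      _ = T := by field_simp
  calc ‖∑ c ∈ (Finset.Icc 1 ⌊5 / 4 * C⌋₊).filter (fun c => r.Coprime c), ∑ h ∈ block H₀ j,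
        ((plateau1 (c / C) : ℝ) : ℂ) * (((c : ℂ))⁻¹ * fcoef (D / 2) (D / 4) c (sgn * h)) *
          kl c r n' (sgn * h)‖
      ≤ ∑ c ∈ (Finset.Icc 1 ⌊5 / 4 * C⌋₊).filter (fun c => r.Coprime c), ∑ h ∈ block H₀ j, T := by
        refine (norm_sum_le _ _).trans (Finset.sum_le_sum fun c hc => ?_)
        exact (norm_sum_le _ _).trans (Finset.sum_le_sum fun h hh => hterm c hc h hh)
    _ = ((Finset.Icc 1 ⌊5 / 4 * C⌋₊).filter (fun c => r.Coprime c)).card * ((block H₀ j).card * T) := by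
        rw [Finset.sum_const, Finset.sum_const, nsmul_eq_mul, nsmul_eq_mul]
    _ ≤ (5 / 4 * C) * (H₀ * T) := by
        gcongr
        · calc (((Finset.Icc 1 ⌊5 / 4 * C⌋₊).filter (fun c => r.Coprime c)).card : ℝ)
              ≤ ((Finset.Icc 1 ⌊5 / 4 * C⌋₊).card : ℝ) := by exact_mod_cast Finset.card_filter_le _ _
            _ = ⌊5 / 4 * C⌋₊ := by rw [Nat.card_Icc]; push_cast; ring
            _ ≤ 5 / 4 * C := Nat.floor_le (by positivity)
        · exact_mod_cast card_block_le H₀ j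
    _ = _ := by ring

/-- Cauchy's inequality for `∑_{r,n} |B_{nr1}|`. [folklore] -/
theorem sum_norm_le_sqrt_card_mul_nb (N : ℕ) (R : ℝ) (B : ℕ → ℕ → ℕ → ℂ) :
    ∑ r ∈ dyadic R, ∑ n ∈ Finset.Icc 1 N, ‖B n r 1‖ ≤
      Real.sqrt ((dyadic R).card * N) * nb N R B := by
  have h := sum3_mul_le_sqrt_mul_sqrt (dyadic R) (Finset.Icc 1 N) ({0} : Finset ℕ)
    (fun _ _ _ => (1 : ℝ)) (fun r n _ => ‖B n r 1‖)
  simp only [one_mul, one_pow, Finset.sum_const, nsmul_eq_mul, mul_one,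
    Nat.card_Icc, add_tsub_cancel_right, Finset.card_singleton, Nat.cast_one] at h
  unfold nb
  exact h

/-- `#{r ∼ R} · ⌊N⌋ ≤ 4RN` (`R ≥ 1/2`, `N ≥ 1`), so `√(#{r∼R} ⌊N⌋) ≤ 2√(RN)`. [folklore] -/
theorem sqrt_card_le {N R : ℝ} (hN : 1 ≤ N) (hR : 1 / 2 ≤ R) :
    Real.sqrt ((dyadic R).card * ⌊N⌋₊) ≤ 2 * Real.sqrt (R * N) := by
  have h1 : ((dyadic R).card : ℝ) ≤ 2 * R + 1 := card_dyadic_le (by linarith)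
  have h2 : (⌊N⌋₊ : ℝ) ≤ N := Nat.floor_le (by linarith)
  have h3 : ((dyadic R).card : ℝ) * ⌊N⌋₊ ≤ 4 * (R * N) := by
    calc ((dyadic R).card : ℝ) * ⌊N⌋₊ ≤ (2 * R + 1) * N := by gcongr
      _ ≤ 4 * (R * N) := by nlinarith
  calc Real.sqrt ((dyadic R).card * ⌊N⌋₊) ≤ Real.sqrt (4 * (R * N)) := Real.sqrt_le_sqrt h3
    _ = 2 * Real.sqrt (R * N) := by
        rw [Real.sqrt_mul (by norm_num), show (4 : ℝ) = 2 ^ 2 by norm_num, Real.sqrt_sq (by norm_num)]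

/-- `⌊log₂ n⌋ + 1 ≤ (1/(δ log 2) + 1) Z^δ` for `n ≤ Z`, `Z ≥ 1`, `δ > 0` (the number of dyadic blocks
is `≪ Z^δ`). [folklore] -/
theorem natLog_two_add_one_le {n : ℕ} {Z δ : ℝ} (hδ : 0 < δ) (hZ : 1 ≤ Z) (hn : (n : ℝ) ≤ Z) :
    ((Nat.log 2 n : ℕ) : ℝ) + 1 ≤ (1 / (δ * Real.log 2) + 1) * Z ^ δ := by
  have hlog2 : 0 < Real.log 2 := Real.log_pos one_lt_two
  have hZδ : 1 ≤ Z ^ δ := Real.one_le_rpow hZ hδ.le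
  have hlogn : ((Nat.log 2 n : ℕ) : ℝ) ≤ Z ^ δ / (δ * Real.log 2) := by
    rcases Nat.eq_zero_or_pos n with h0 | hpos
    · subst h0
      simp only [Nat.log_zero_right, Nat.cast_zero]
      positivity
    · have h1 : (2 : ℝ) ^ Nat.log 2 n ≤ n := by exact_mod_cast Nat.pow_log_le_self 2 hpos.ne'
      have h2 : (Nat.log 2 n : ℝ) * Real.log 2 ≤ Real.log Z := by
        rw [← Real.log_pow]
        exact Real.log_le_log (by positivity) (h1.trans hn)
      have h3 : Real.log Z ≤ Z ^ δ / δ := Real.log_le_rpow_div (by linarith) hδ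
      rw [le_div_iff₀ (by positivity)]
      calc (Nat.log 2 n : ℝ) * (δ * Real.log 2) = δ * ((Nat.log 2 n : ℝ) * Real.log 2) := by ring
        _ ≤ δ * (Z ^ δ / δ) := by gcongr; exact h2.trans h3
        _ = Z ^ δ := by field_simp
  calc ((Nat.log 2 n : ℕ) : ℝ) + 1 ≤ Z ^ δ / (δ * Real.log 2) + Z ^ δ := add_le_add hlogn hZδ
    _ = _ := by ring

/-- Absorbing powers of the size parameter by the tail decay: for `U ≥ 1`, `0 ≤ a ≤ b`,
`U^a (U/4)^{−b} ≤ 4^b`. [folklore] -/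
theorem rpow_mul_rpow_neg_le {U a b : ℝ} (hU : 1 ≤ U) (hab : a ≤ b) :
    U ^ a * (U / 4) ^ (-b) ≤ (4 : ℝ) ^ b := by
  have hU0 : 0 < U := by linarith
  rw [Real.div_rpow hU0.le (by norm_num : (0:ℝ) ≤ 4), Real.rpow_neg (by norm_num : (0:ℝ) ≤ 4),
    div_inv_eq_mul]
  calc U ^ a * (U ^ (-b) * (4 : ℝ) ^ b) = U ^ (a + -b) * (4 : ℝ) ^ b := by
        rw [Real.rpow_add hU0]; ring
    _ ≤ 1 * (4 : ℝ) ^ b := by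
        gcongr
        exact Real.rpow_le_one_of_one_le_of_nonpos hU (by linarith)
    _ = (4 : ℝ) ^ b := one_mul _



/-! ### Assembly: the off-diagonal bound at `s = 1` from Theorem 11 -/

set_option maxHeartbeats 800000 in
/-- **Deshouillers–Iwaniec §9.2 at `s = 1`: the off-diagonal bound from Theorem 11.**  If Theorem 11
of the source holds (at `s = 1`) for the dilations of every smooth weight compactly supported in
`[1, 2] × (0, ∞)`, then the off-diagonal part `𝓚♯` of BFI's `𝓚(C, D, N, R, 1/2)` satisfies the bound
demanded by `BFI.k1HalfFor_of_offdiag_half`: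
`‖𝓚♯(H₀)‖ ≤ K (CDNR/2)^ε {C·½·(R/2 + N)(C + DR) + C²D·½·√((R/2 + N)R)}^{1/2} ‖B‖`,
`H₀ = ⌈(CDNR/2)^ε C/D⌉`.  Proof as printed (pp. 281–282): dyadic blocks `(M₁, 2M₁]` of frequencies,
`c⁻¹Φ_c(h) = h⁻¹∫ w(ξc/(hD)) e(−ξ) dξ`, Theorem 11 for the weight `h⁻¹ w(c/C) w(ξc/(hD))` on the
`ξ`-range `Ξ_j` of length `≍ DM₁/C`, the maximum over `M₁ ≤ H₀` ((9.14)); the blocks with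
`M₁ > (CDNR/2)^{ε/2} C/D` are treated directly by the Fourier decay of `Φ_c`.
[cite: DeshouillersIwaniec1982, §9.2 pp. 280–282, Theorem 12 p. 237] -/
theorem offdiag_half_of_di11
    (h11 : ∀ g₀ : ℝ × ℝ → ℝ, ContDiff ℝ ∞ g₀ → HasCompactSupport g₀ →
      tsupport g₀ ⊆ Set.Icc (1 : ℝ) 2 ×ˢ Set.Ioi (0 : ℝ) → DI11For g₀)
    {ε : ℝ} (hε : 0 < ε) :
    ∃ K : ℝ, ∀ C D N R : ℝ, 1 ≤ C → 1 ≤ D → 1 ≤ N → 1 / 2 ≤ R → ∀ B : ℕ → ℕ → ℕ → ℂ,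
      ‖Koff C D ⌊N⌋₊ R (1 / 2) ⌈2 * (C * D * N * R * (1 / 2)) ^ ε * (1 / 2) * C / D⌉₊ B‖ ≤
        K * (C * D * N * R * (1 / 2)) ^ ε *
          Real.sqrt (C * (1 / 2) * (R * (1 / 2) + N) * (C + D * R) +
            C ^ 2 * D * (1 / 2) * Real.sqrt ((R * (1 / 2) + N) * R)) *
          lemma1Norm ⌊N⌋₊ R (1 / 2) B := by
  -- parameters
  set ε₁ : ℝ := ε / (4 * (4 + ε)) with hε₁
  have hε₁0 : 0 < ε₁ := by positivity
  have hε₁1 : ε₁ ≤ 1 := by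
    rw [hε₁, div_le_one (by positivity)]; nlinarith
  have hA2 : (4 + ε) * ε₁ = ε / 4 := by rw [hε₁]; field_simp
  have hA1 : (1 + ε) * ε₁ ≤ (4 + ε) * ε₁ := mul_le_mul_of_nonneg_right (by linarith) hε₁0.le
  have hA3 : (1 + ε) * ε₁ + (4 + ε) * ε₁ + ε / 2 ≤ ε := by linarith
  set nn : ℕ := ⌈8 / ε⌉₊ + 3 with hnn
  have hnn1 : 1 ≤ nn := by omega
  have hnnε : 4 + ε + (1 + ε) * ε₁ ≤ ε * nn / 2 := by
    have h1 : 8 / ε ≤ ⌈8 / ε⌉₊ := Nat.le_ceil _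
    have h2 : (nn : ℝ) = ⌈8 / ε⌉₊ + 3 := by rw [hnn]; push_cast; ring
    have h3 : 8 / ε + 3 ≤ nn := by linarith
    have h4 : ε * (8 / ε + 3) / 2 = 4 + 3 * ε / 2 := by field_simp; ring
    have h5 : ε * (8 / ε + 3) / 2 ≤ ε * nn / 2 := by gcongr
    have h6 : (1 + ε) * ε₁ ≤ ε / 2 := by
      rw [hε₁]
      rw [show (1 + ε) * (ε / (4 * (4 + ε))) = ε * ((1 + ε) / (4 * (4 + ε))) by ring]
      have : (1 + ε) / (4 * (4 + ε)) ≤ 1 / 2 := by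
        rw [div_le_div_iff₀ (by positivity) (by norm_num)]; nlinarith
      nlinarith
    linarith
  -- the constants from Theorem 11 for the three master weights
  have hG : ∀ i, DI11For (Gw i) := fun i =>
    h11 (Gw i) (contDiff_Gw i) (hasCompactSupport_Gw i) (tsupport_Gw_subset i)
  obtain ⟨K0, hK0⟩ := hG 0 ε₁ hε₁0
  obtain ⟨K1, hK1⟩ := hG 1 ε₁ hε₁0
  obtain ⟨K2, hK2⟩ := hG 2 ε₁ hε₁0
  set K : ℝ := max (max (max K0 K1) K2) 0 with hK
  have hKnn : 0 ≤ K := le_max_right _ _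
  have hK0' : K0 ≤ K := ((le_max_left K0 K1).trans (le_max_left _ K2)).trans (le_max_left _ 0)
  have hK1' : K1 ≤ K := ((le_max_right K0 K1).trans (le_max_left _ K2)).trans (le_max_left _ 0)
  have hK2' : K2 ≤ K := (le_max_right _ K2).trans (le_max_left _ 0)
  set Kn : ℝ := derivConst nn with hKn
  have hKn1 : 1 ≤ Kn := one_le_derivConst nn
  set cδ : ℝ := 1 / (ε₁ * Real.log 2) + 1 with hcδ
  have hlog2 : 0 < Real.log 2 := Real.log_pos one_lt_two
  have hcδ0 : 0 ≤ cδ := by positivity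
  refine ⟨(4 : ℝ) ^ ε * (cδ * 2400 * Real.sqrt 20 * Real.sqrt 11 * K +
    20 * Real.sqrt 2 * cδ * Kn * (4 : ℝ) ^ (ε * nn / 2)), ?_⟩
  intro C D N R hC hD hN hR B
  have hC0 : 0 < C := by linarith
  have hD0 : 0 < D := by linarith
  have hN0 : 0 < N := by linarith
  have hR0 : 0 < R := by linarith
  -- sizes: `P = CDNR/2`, `U = 4P = 2CDNR ≥ 1`
  set P : ℝ := C * D * N * R * (1 / 2) with hP
  have hP0 : 0 < P := by positivity
  set U : ℝ := 4 * P with hU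
  have hU0 : 0 < U := by positivity
  have hUeq : U = 2 * (C * D * N * R) := by rw [hU, hP]; ring
  have hU1 : 1 ≤ U := by
    rw [hUeq]
    nlinarith [mul_nonneg hC0.le hD0.le, mul_nonneg hN0.le hR0.le,
      mul_le_mul hC hD zero_le_one hC0.le, mul_le_mul hN hR (by norm_num) hN0.le]
  have hCU : C ≤ U := by
    rw [hUeq]
    have : 1 ≤ 2 * (D * N * R) := by nlinarith [mul_le_mul hD hN zero_le_one hD0.le, mul_nonneg hD0.le hN0.le]
    nlinarith
  have hDU : D ≤ U := by
    rw [hUeq]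
    have : 1 ≤ 2 * (C * N * R) := by nlinarith [mul_le_mul hC hN zero_le_one hC0.le, mul_nonneg hC0.le hN0.le]
    nlinarith
  have hNU : N ≤ U := by
    rw [hUeq]
    have : 1 ≤ 2 * (C * D * R) := by nlinarith [mul_le_mul hC hD zero_le_one hC0.le, mul_nonneg hC0.le hD0.le]
    nlinarith
  have hRU : R ≤ U := by
    rw [hUeq]
    have : 1 ≤ 2 * (C * D * N) := by nlinarith [mul_le_mul hC hD zero_le_one hC0.le, mul_nonneg hC0.le hD0.le]
    nlinarith
  have hRNU : Real.sqrt (R * N) ≤ U := by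
    rw [← Real.sqrt_sq hU0.le]
    exact Real.sqrt_le_sqrt (by rw [sq]; exact mul_le_mul hRU hNU hN0.le hU0.le)
  have hPU : P ≤ U := by rw [hU]; linarith
  have hPε : P ^ ε ≤ U ^ ε := Real.rpow_le_rpow hP0.le hPU hε.le
  have hUε4 : U ^ ε = (4 : ℝ) ^ ε * P ^ ε := by rw [hU, Real.mul_rpow (by norm_num) hP0.le]
  -- `λ = P^{ε/2}`
  set lam : ℝ := P ^ (ε / 2) with hlam
  have hlam0 : 0 < lam := Real.rpow_pos_of_pos hP0 _
  have hmaxlam : max 1 lam ≤ U ^ (ε / 2) :=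
    max_le (Real.one_le_rpow hU1 (by positivity)) (Real.rpow_le_rpow hP0.le hPU (by positivity))
  -- `H₀`
  set H₀ : ℕ := ⌈2 * P ^ ε * (1 / 2) * C / D⌉₊ with hH₀
  have hH₀arg : 2 * P ^ ε * (1 / 2) * C / D = P ^ ε * C / D := by ring
  have hH₀pos : 1 ≤ H₀ := by
    rw [hH₀, Nat.one_le_ceil_iff, hH₀arg]; positivity
  have hU1ε : 1 ≤ U ^ (1 + ε) := Real.one_le_rpow hU1 (by linarith)
  have hH₀le : (H₀ : ℝ) ≤ 2 * U ^ (1 + ε) := by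
    have h1 : (H₀ : ℝ) < P ^ ε * C / D + 1 := by rw [hH₀, hH₀arg]; exact Nat.ceil_lt_add_one (by positivity)
    have h2 : P ^ ε * C / D ≤ U ^ ε * U := by
      rw [div_le_iff₀ hD0]
      have h21 : P ^ ε * C ≤ U ^ ε * U := mul_le_mul hPε hCU hC0.le (Real.rpow_nonneg hU0.le _)
      have h22 : U ^ ε * U ≤ U ^ ε * U * D := by
        have h0 : 0 ≤ U ^ ε * U := mul_nonneg (Real.rpow_nonneg hU0.le ε) hU0.le
        nlinarith only [h0, hD]
      exact h21.trans h22
    have h3 : U ^ ε * U = U ^ (1 + ε) := by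
      rw [add_comm, Real.rpow_add hU0, Real.rpow_one]
    calc (H₀ : ℝ) ≤ P ^ ε * C / D + 1 := h1.le
      _ ≤ U ^ (1 + ε) + 1 := by rw [← h3]; linarith only [h2]
      _ ≤ 2 * U ^ (1 + ε) := by linarith only [hU1ε]
  have h2jle : ∀ j ∈ Finset.range (Nat.log 2 H₀ + 1), (2 : ℝ) ^ j ≤ 2 * U ^ (1 + ε) :=
    fun j hj => (two_pow_le_of_mem_range' hH₀pos hj).trans hH₀le
  -- the target quantity `𝓚² = Tq ≥ 1/2`
  set Tq : ℝ := C * (1 / 2) * (R * (1 / 2) + N) * (C + D * R) +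
    C ^ 2 * D * (1 / 2) * Real.sqrt ((R * (1 / 2) + N) * R) with hTq
  have hTq0 : 1 / 2 ≤ Tq := by
    rw [hTq]
    have h1 : 0 ≤ C ^ 2 * D * (1 / 2) * Real.sqrt ((R * (1 / 2) + N) * R) := by positivity
    have e : C * (1 / 2) * (R * (1 / 2) + N) * (C + D * R) =
        C * N * C * (1 / 2) + C * (1 / 2) * (R * (1 / 2) * (C + D * R) + N * (D * R)) := by ring
    have h3 : 0 ≤ C * (1 / 2) * (R * (1 / 2) * (C + D * R) + N * (D * R)) := by positivity
    have h4 : (1 : ℝ) ≤ C * N := by nlinarith only [hC, hN]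
    have h5 : (1 : ℝ) ≤ C * N * C := by nlinarith only [h4, hC]
    rw [e]
    linarith only [h1, h3, h5]
  have hsT : 1 ≤ Real.sqrt 2 * Real.sqrt Tq := by
    rw [← Real.sqrt_mul (by norm_num)]
    rw [show (1:ℝ) = Real.sqrt 1 from Real.sqrt_one.symm]
    exact Real.sqrt_le_sqrt (by linarith)
  have hsT0 : 0 ≤ Real.sqrt Tq := Real.sqrt_nonneg _
  set nB : ℝ := nb ⌊N⌋₊ R B with hnB
  have hnB0 : 0 ≤ nB := nb_nonneg _ _ _
  -- Theorem 11 for the three weights with the common constant `K`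
  have hKall : ∀ i ∈ Finset.range 3, ∀ C' M' : ℝ, 0 < C' → 0 < M' → ∀ b : ℕ → ℕ → ℂ, ∀ m₁ m₂ : ℕ,
      1 ≤ m₁ → ∀ sgn : ℤ, (sgn = 1 ∨ sgn = -1) →
        ‖diSum (Gw i) C' M' ⌊N⌋₊ R m₁ m₂ sgn b‖ ≤
          K * (C' * M' * N * R) ^ ε₁ * diL C' M' N R * Real.sqrt M' *
            Real.sqrt (∑ r ∈ dyadic R, ∑ n ∈ Finset.Icc 1 ⌊N⌋₊, ‖b n r‖ ^ 2) := by
    intro i hi C' M' hC' hM' b m₁ m₂ hm₁ sgn hs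
    have hfac : 0 ≤ (C' * M' * N * R) ^ ε₁ * diL C' M' N R * Real.sqrt M' *
        Real.sqrt (∑ r ∈ dyadic R, ∑ n ∈ Finset.Icc 1 ⌊N⌋₊, ‖b n r‖ ^ 2) := by
      have := diL_nonneg C' M' N R
      positivity
    have key : ∀ K' : ℝ, K' ≤ K →
        ‖diSum (Gw i) C' M' ⌊N⌋₊ R m₁ m₂ sgn b‖ ≤
          K' * (C' * M' * N * R) ^ ε₁ * diL C' M' N R * Real.sqrt M' *
            Real.sqrt (∑ r ∈ dyadic R, ∑ n ∈ Finset.Icc 1 ⌊N⌋₊, ‖b n r‖ ^ 2) →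
        ‖diSum (Gw i) C' M' ⌊N⌋₊ R m₁ m₂ sgn b‖ ≤
          K * (C' * M' * N * R) ^ ε₁ * diL C' M' N R * Real.sqrt M' *
            Real.sqrt (∑ r ∈ dyadic R, ∑ n ∈ Finset.Icc 1 ⌊N⌋₊, ‖b n r‖ ^ 2) := by
      intro K' hK' h
      calc ‖diSum (Gw i) C' M' ⌊N⌋₊ R m₁ m₂ sgn b‖
          ≤ K' * (C' * M' * N * R) ^ ε₁ * diL C' M' N R * Real.sqrt M' *
            Real.sqrt (∑ r ∈ dyadic R, ∑ n ∈ Finset.Icc 1 ⌊N⌋₊, ‖b n r‖ ^ 2) := h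
        _ = K' * ((C' * M' * N * R) ^ ε₁ * diL C' M' N R * Real.sqrt M' *
            Real.sqrt (∑ r ∈ dyadic R, ∑ n ∈ Finset.Icc 1 ⌊N⌋₊, ‖b n r‖ ^ 2)) := by ring
        _ ≤ K * ((C' * M' * N * R) ^ ε₁ * diL C' M' N R * Real.sqrt M' *
            Real.sqrt (∑ r ∈ dyadic R, ∑ n ∈ Finset.Icc 1 ⌊N⌋₊, ‖b n r‖ ^ 2)) :=
            mul_le_mul_of_nonneg_right hK' hfac
        _ = _ := by ring
    have hi3 : i = 0 ∨ i = 1 ∨ i = 2 := by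
      have := Finset.mem_range.1 hi; omega
    rcases hi3 with rfl | rfl | rfl
    · exact key K0 hK0' (hK0 C' M' N R hC' hM' hN hR b m₁ m₂ hm₁ sgn hs)
    · exact key K1 hK1' (hK1 C' M' N R hC' hM' hN hR b m₁ m₂ hm₁ sgn hs)
    · exact key K2 hK2' (hK2 C' M' N R hC' hM' hN hR b m₁ m₂ hm₁ sgn hs)
  -- uniform bound for every block and sign
  set BM : ℝ := 30 * Real.sqrt 20 * K * (20 * U ^ (4 + ε)) ^ ε₁ *
    (Real.sqrt 11 * U ^ (ε / 2) * Real.sqrt Tq) * nB with hBM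
  set TM : ℝ := 2 * U * nB * ((5 / 4 * U) * (2 * U ^ (1 + ε)) * (Kn * U * (lam⁻¹) ^ nn)) with hTM
  have hBM0 : 0 ≤ BM := by positivity
  have hTM0 : 0 ≤ TM := by
    have : 0 ≤ Kn := by linarith
    positivity
  have hblock : ∀ j ∈ Finset.range (Nat.log 2 H₀ + 1), ∀ sgn : ℤ, (sgn = 1 ∨ sgn = -1) →
      ‖blockSum C D ⌊N⌋₊ R H₀ B j sgn‖ ≤ BM + TM := by
    intro j hj sgn hs
    have h2j : (0 : ℝ) < 2 ^ j := by positivity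
    have h2jU := h2jle j hj
    rcases le_or_gt ((2 : ℝ) ^ j) (lam * C / D) with hbulk | htail
    · -- bulk block
      have h1 := norm_blockSum_le_bulk' hC hD hN hR hε₁0 hKnn hKall H₀ B j hs
      have hX : (10 * C * 2 ^ j * N * R) ^ ε₁ ≤ (20 * U ^ (4 + ε)) ^ ε₁ := by
        refine Real.rpow_le_rpow (by positivity) ?_ hε₁0.le
        have e : 20 * U ^ (4 + ε) = 10 * U * (2 * U ^ (1 + ε)) * U * U := by
          rw [show (4 : ℝ) + ε = 1 + (1 + ε) + 1 + 1 by ring, Real.rpow_add hU0, Real.rpow_add hU0,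
            Real.rpow_add hU0, Real.rpow_one]
          ring
        rw [e]
        have := mul_le_mul (mul_le_mul (mul_le_mul_of_nonneg_left hCU (by norm_num : (0:ℝ) ≤ 10))
          h2jU h2j.le (by positivity)) hNU hN0.le (by positivity)
        exact mul_le_mul this hRU hR0.le (by positivity)
      have hrange : Real.sqrt ((D / C) ^ 2 * 2 ^ j * Lam C (10 * 2 ^ j) N R) ≤
          Real.sqrt 11 * U ^ (ε / 2) * Real.sqrt Tq := by
        have h2 := range_bound hC hD hN hR h2j.le hbulk
        calc Real.sqrt ((D / C) ^ 2 * 2 ^ j * Lam C (10 * 2 ^ j) N R)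
            ≤ Real.sqrt (11 * max 1 lam ^ 2 * Tq) := Real.sqrt_le_sqrt h2
          _ = Real.sqrt 11 * max 1 lam * Real.sqrt Tq := by
              rw [Real.sqrt_mul (by positivity), Real.sqrt_mul (by norm_num),
                Real.sqrt_sq (le_trans zero_le_one (le_max_left _ _))]
          _ ≤ Real.sqrt 11 * U ^ (ε / 2) * Real.sqrt Tq := by gcongr
      calc ‖blockSum C D ⌊N⌋₊ R H₀ B j sgn‖
          ≤ 30 * Real.sqrt 20 * K * (10 * C * 2 ^ j * N * R) ^ ε₁ *
              Real.sqrt ((D / C) ^ 2 * 2 ^ j * Lam C (10 * 2 ^ j) N R) * nb ⌊N⌋₊ R B := h1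
        _ ≤ BM := by rw [hBM, hnB]; gcongr
        _ ≤ BM + TM := le_add_of_nonneg_right hTM0
    · -- tail block
      have h1 := norm_blockSum_le_tail hC hD ⌊N⌋₊ R hlam0 hnn1 H₀ B htail hs
      have h2 := (sum_norm_le_sqrt_card_mul_nb ⌊N⌋₊ R B).trans
        (mul_le_mul_of_nonneg_right (sqrt_card_le hN hR) (nb_nonneg _ _ _))
      have hKn0 : 0 ≤ Kn := by linarith
      calc ‖blockSum C D ⌊N⌋₊ R H₀ B j sgn‖
          ≤ (∑ r ∈ dyadic R, ∑ n ∈ Finset.Icc 1 ⌊N⌋₊, ‖B n r 1‖) *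
              ((5 / 4 * C) * H₀ * (Kn * D * (lam⁻¹) ^ nn)) := h1
        _ ≤ (2 * Real.sqrt (R * N) * nb ⌊N⌋₊ R B) *
              ((5 / 4 * U) * (2 * U ^ (1 + ε)) * (Kn * U * (lam⁻¹) ^ nn)) := by
            gcongr
        _ ≤ TM := by
            rw [hTM, hnB]
            gcongr
        _ ≤ BM + TM := le_add_of_nonneg_left hBM0
  -- summing the blocks
  have hJ : ((Nat.log 2 H₀ : ℕ) : ℝ) + 1 ≤ cδ * (2 * U ^ (1 + ε)) ^ ε₁ :=
    natLog_two_add_one_le hε₁0 (by linarith) hH₀le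
  have hsum : ‖Koff C D ⌊N⌋₊ R (1 / 2) H₀ B‖ ≤ (cδ * (2 * U ^ (1 + ε)) ^ ε₁) * (2 * (BM + TM)) := by
    rw [Koff_half_eq_sum_blockSum]
    refine (norm_sum_le _ _).trans ?_
    calc ∑ j ∈ Finset.range (Nat.log 2 H₀ + 1), ‖blockSum C D ⌊N⌋₊ R H₀ B j 1 + blockSum C D ⌊N⌋₊ R H₀ B j (-1)‖
        ≤ ∑ j ∈ Finset.range (Nat.log 2 H₀ + 1), 2 * (BM + TM) := by
          refine Finset.sum_le_sum fun j hj => (norm_add_le _ _).trans ?_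
          have ha := hblock j hj 1 (Or.inl rfl)
          have hb := hblock j hj (-1) (Or.inr rfl)
          linarith only [ha, hb]
      _ = (((Nat.log 2 H₀ : ℕ) : ℝ) + 1) * (2 * (BM + TM)) := by
          rw [Finset.sum_const, Finset.card_range, nsmul_eq_mul]; push_cast; ring
      _ ≤ (cδ * (2 * U ^ (1 + ε)) ^ ε₁) * (2 * (BM + TM)) :=
          mul_le_mul_of_nonneg_right hJ (by positivity)
  refine hsum.trans ?_
  rw [lemma1Norm_half, ← hnB]
  -- numerics: `(2U^{1+ε})^{ε₁} ≤ 2 U^{(1+ε)ε₁}`, `20^{ε₁} ≤ 20`, exponents of `U`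
  have hE1 : (2 * U ^ (1 + ε)) ^ ε₁ ≤ 2 * U ^ ((1 + ε) * ε₁) := by
    rw [Real.mul_rpow (by norm_num) (Real.rpow_nonneg hU0.le _), ← Real.rpow_mul hU0.le]
    refine mul_le_mul_of_nonneg_right ?_ (Real.rpow_nonneg hU0.le _)
    calc (2 : ℝ) ^ ε₁ ≤ 2 ^ (1 : ℝ) := Real.rpow_le_rpow_of_exponent_le (by norm_num) hε₁1
      _ = 2 := Real.rpow_one _
  have hE2 : (20 * U ^ (4 + ε)) ^ ε₁ ≤ 20 * U ^ ((4 + ε) * ε₁) := by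
    rw [Real.mul_rpow (by norm_num) (Real.rpow_nonneg hU0.le _), ← Real.rpow_mul hU0.le]
    refine mul_le_mul_of_nonneg_right ?_ (Real.rpow_nonneg hU0.le _)
    calc (20 : ℝ) ^ ε₁ ≤ 20 ^ (1 : ℝ) := Real.rpow_le_rpow_of_exponent_le (by norm_num) hε₁1
      _ = 20 := Real.rpow_one _
  -- the bulk part
  have hexp1 : U ^ ((1 + ε) * ε₁) * U ^ ((4 + ε) * ε₁) * U ^ (ε / 2) ≤ U ^ ε := by
    rw [← Real.rpow_add hU0, ← Real.rpow_add hU0]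
    exact Real.rpow_le_rpow_of_exponent_le hU1 hA3
  have hbulk_part : (cδ * (2 * U ^ (1 + ε)) ^ ε₁) * (2 * BM) ≤
      (4 : ℝ) ^ ε * (cδ * 2400 * Real.sqrt 20 * Real.sqrt 11 * K) * P ^ ε * Real.sqrt Tq * nB := by
    calc (cδ * (2 * U ^ (1 + ε)) ^ ε₁) * (2 * BM)
        ≤ (cδ * (2 * U ^ ((1 + ε) * ε₁))) * (2 * (30 * Real.sqrt 20 * K * (20 * U ^ ((4 + ε) * ε₁)) *
            (Real.sqrt 11 * U ^ (ε / 2) * Real.sqrt Tq) * nB)) := by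
          rw [hBM]; gcongr
      _ = cδ * 2400 * Real.sqrt 20 * Real.sqrt 11 * K *
            (U ^ ((1 + ε) * ε₁) * U ^ ((4 + ε) * ε₁) * U ^ (ε / 2)) * Real.sqrt Tq * nB := by ring
      _ ≤ cδ * 2400 * Real.sqrt 20 * Real.sqrt 11 * K * U ^ ε * Real.sqrt Tq * nB := by gcongr
      _ = _ := by rw [hUε4]; ring
  -- the tail part
  have hexp2 : U ^ ((1 + ε) * ε₁) * (U * (U * U ^ (1 + ε) * U)) * (lam⁻¹) ^ nn ≤
      (4 : ℝ) ^ (ε * nn / 2) := by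
    have e1 : U ^ ((1 + ε) * ε₁) * (U * (U * U ^ (1 + ε) * U)) = U ^ (4 + ε + (1 + ε) * ε₁) := by
      symm
      rw [show (4 : ℝ) + ε + (1 + ε) * ε₁ = (1 + ε) * ε₁ + (1 + (1 + ((1 + ε) + 1))) by ring,
        Real.rpow_add hU0, Real.rpow_add hU0, Real.rpow_add hU0, Real.rpow_add hU0, Real.rpow_one]
      ring
    have e2 : (lam⁻¹) ^ nn = (U / 4) ^ (-(ε * nn / 2)) := by
      rw [hlam, show U / 4 = P by rw [hU]; ring, ← Real.rpow_neg hP0.le, ← Real.rpow_natCast,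
        ← Real.rpow_mul hP0.le]
      congr 1; ring
    rw [e1, e2]
    exact rpow_mul_rpow_neg_le hU1 hnnε
  have htail_part : (cδ * (2 * U ^ (1 + ε)) ^ ε₁) * (2 * TM) ≤
      (4 : ℝ) ^ ε * (20 * Real.sqrt 2 * cδ * Kn * (4 : ℝ) ^ (ε * nn / 2)) * P ^ ε * Real.sqrt Tq * nB := by
    have hKn0 : 0 ≤ Kn := by linarith
    have h1 : (cδ * (2 * U ^ (1 + ε)) ^ ε₁) * (2 * TM) ≤
        (cδ * (2 * U ^ ((1 + ε) * ε₁))) * (2 * TM) := by gcongr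
    have h2 : (cδ * (2 * U ^ ((1 + ε) * ε₁))) * (2 * TM) =
        20 * cδ * Kn * (U ^ ((1 + ε) * ε₁) * (U * (U * U ^ (1 + ε) * U)) * (lam⁻¹) ^ nn) * nB := by
      rw [hTM]; ring
    have h3 : 20 * cδ * Kn * (U ^ ((1 + ε) * ε₁) * (U * (U * U ^ (1 + ε) * U)) * (lam⁻¹) ^ nn) * nB ≤
        20 * cδ * Kn * (4 : ℝ) ^ (ε * nn / 2) * nB := by gcongr
    have h4 : 20 * cδ * Kn * (4 : ℝ) ^ (ε * nn / 2) * nB ≤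
        20 * cδ * Kn * (4 : ℝ) ^ (ε * nn / 2) * nB * (Real.sqrt 2 * Real.sqrt Tq) * ((4 : ℝ) ^ ε * P ^ ε) := by
      have hbase : 0 ≤ 20 * cδ * Kn * (4 : ℝ) ^ (ε * nn / 2) * nB := by positivity
      have h14 : 1 ≤ (4 : ℝ) ^ ε * P ^ ε := by
        rw [← Real.mul_rpow (by norm_num) hP0.le, ← hU]
        exact Real.one_le_rpow hU1 hε.le
      calc 20 * cδ * Kn * (4 : ℝ) ^ (ε * nn / 2) * nB
          = 20 * cδ * Kn * (4 : ℝ) ^ (ε * nn / 2) * nB * 1 * 1 := by ring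
        _ ≤ 20 * cδ * Kn * (4 : ℝ) ^ (ε * nn / 2) * nB * (Real.sqrt 2 * Real.sqrt Tq) * ((4 : ℝ) ^ ε * P ^ ε) := by
            gcongr
    calc (cδ * (2 * U ^ (1 + ε)) ^ ε₁) * (2 * TM) ≤ (cδ * (2 * U ^ ((1 + ε) * ε₁))) * (2 * TM) := h1
      _ = _ := h2
      _ ≤ _ := h3
      _ ≤ _ := h4
      _ = _ := by ring
  calc (cδ * (2 * U ^ (1 + ε)) ^ ε₁) * (2 * (BM + TM))
      = (cδ * (2 * U ^ (1 + ε)) ^ ε₁) * (2 * BM) + (cδ * (2 * U ^ (1 + ε)) ^ ε₁) * (2 * TM) := by ring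
    _ ≤ (4 : ℝ) ^ ε * (cδ * 2400 * Real.sqrt 20 * Real.sqrt 11 * K) * P ^ ε * Real.sqrt Tq * nB +
        (4 : ℝ) ^ ε * (20 * Real.sqrt 2 * cδ * Kn * (4 : ℝ) ^ (ε * nn / 2)) * P ^ ε * Real.sqrt Tq * nB :=
        add_le_add hbulk_part htail_part
    _ = _ := by rw [hTq]; ring



end L1

/-- **`BFI.K1HalfFor BFI.plateau2 (5/4)` from Deshouillers–Iwaniec's Theorem 11 at `s = 1`.**
[cite: DeshouillersIwaniec1982, §1.4 Theorem 11 p. 236; BombieriFriedlanderIwaniec2019, §2 Lemma 2.1] -/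
theorem k1HalfFor_of_di11
    (h11 : ∀ g₀ : ℝ × ℝ → ℝ, ContDiff ℝ ∞ g₀ → HasCompactSupport g₀ →
      tsupport g₀ ⊆ Set.Icc (1 : ℝ) 2 ×ˢ Set.Ioi (0 : ℝ) → L1.DI11For g₀) :
    K1HalfFor plateau2 (5 / 4) :=
  k1HalfFor_of_offdiag_half fun _ hε => L1.offdiag_half_of_di11 h11 hε

end BFI

open BFI

section Consequences

variable (h11 : ∀ g₀ : ℝ × ℝ → ℝ, ContDiff ℝ ∞ g₀ → HasCompactSupport g₀ →
  tsupport g₀ ⊆ Set.Icc (1 : ℝ) 2 ×ˢ Set.Ioi (0 : ℝ) → BFI.L1.DI11For g₀)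
include h11

/-- **BFI 1986, Theorem 5 (§12, p. 237) from Deshouillers–Iwaniec's Theorem 11 at `s = 1`.**
[cite: BombieriFriedlanderIwaniecActa1986, §12 Theorem 5 p. 237; DeshouillersIwaniec1982, §1.4 Theorem 11 p. 236] -/
theorem BombieriFriedlanderIwaniecTheorem5_of_di11 : BombieriFriedlanderIwaniecTheorem5 :=
  BombieriFriedlanderIwaniecTheorem5_of_offdiag_half fun _ hε => BFI.L1.offdiag_half_of_di11 h11 hε

/-- **BFI 1986, Theorem 1 (§8, p. 225) from Deshouillers–Iwaniec's Theorem 11 at `s = 1`.**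
[cite: BombieriFriedlanderIwaniecActa1986, §8 Theorem 1 p. 225; DeshouillersIwaniec1982, §1.4 Theorem 11 p. 236] -/
theorem BombieriFriedlanderIwaniecTheorem1_of_di11 : BombieriFriedlanderIwaniecTheorem1 :=
  BombieriFriedlanderIwaniecTheorem1_of_offdiag_half fun _ hε => BFI.L1.offdiag_half_of_di11 h11 hε

/-- **BFI 1986, Theorem 10 (p. 209) from Deshouillers–Iwaniec's Theorem 11 at `s = 1`.**
[cite: BombieriFriedlanderIwaniecActa1986, Theorem 10 p. 209; DeshouillersIwaniec1982, §1.4 Theorem 11 p. 236] -/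
theorem BombieriFriedlanderIwaniecTheorem10_of_di11 : BombieriFriedlanderIwaniecTheorem10 :=
  BombieriFriedlanderIwaniecTheorem10_of_offdiag_half fun _ hε => BFI.L1.offdiag_half_of_di11 h11 hε

/-- **The fact `bfi_wellFactorable_level` from Deshouillers–Iwaniec's Theorem 11 at `s = 1`.**
[cite: BombieriFriedlanderIwaniecActa1986, Theorem 10 p. 209] -/
theorem bfi_wellFactorable_level_of_di11 : bfi_wellFactorable_level :=
  bfi_wellFactorable_level_of_offdiag_half fun _ hε => BFI.L1.offdiag_half_of_di11 h11 hε

/-- **The twin-prime sieve bound `twinSieve_bfi` from Deshouillers–Iwaniec's Theorem 11 at `s = 1`.**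
[cite: BombieriFriedlanderIwaniecActa1986, Theorem 10 p. 209] -/
theorem twinSieve_bfi_of_di11 : twinSieve_bfi :=
  twinSieve_bfi_of_offdiag_half fun _ hε => BFI.L1.offdiag_half_of_di11 h11 hε

end Consequences

end Literature.NumberTheory.Sieve
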